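import Literature.Analysis.FluidPDE.TorusVorticityDirectionSixPoint
import Literature.Analysis.FluidPDE.TorusNSEnstrophyContinuation
import Literature.Analysis.FluidPDE.TorusClassicalNSH3Smoothing
import Literature.Analysis.FluidPDE.TorusNSLadderInequality
import Literature.Analysis.FluidPDE.TorusStrainVorticityOrthogonality
import Literature.Analysis.FluidPDE.TorusStrainVorticityIsometry
import Literature.Analysis.FluidPDE.TorusClassicalNSMaximalSolution
import Literature.Analysis.FunctionSpaces.TorusLerayHelmholtzH1

/-!
# Berselli 2023, Theorem 1.1 on `T³`: the vorticity direction at the six grid points `x ± λeⱼ`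
# and continuation of classical Navier–Stokes solutions

Analysis/FluidPDE proof file (theorems only; no definitions, no named facts).

search for candidate a priori estimates; no regularity claim (cell `pub-nsfunc`, literature seat:
this file types the PRINTED Theorem 1.1 of [Berselli2023] on the torus, in the continuation form
used for every criterion of this directory, by the printed proof; it claims nothing new).
HONEST SCOPE: a PRINTED conditional regularity criterion typed as printed for the classical
class — criterion-only; no claim about solutions beyond the cited theorem; no node of this cell
decided.

Source: L. C. Berselli, *On the vorticity direction and the regularity of 3D Navier–Stokes
equations*, Nonlinearity 36 (2023) 4303–4313. Printed (p. 4305):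

"**Theorem 1.1.** Let us consider either the space-periodic problem (`x ∈ 𝕋³`) or the Cauchy
problem (`x ∈ ℝ³`). Let `u` be a Leray–Hopf weak solution of the NSE in `(0, T)`, with
`u₀ ∈ H¹`. Then, there exist constants `λ = λ(ν, T, ‖∇u₀‖) > 0` and
`C̄₁ = C̄₁(ν, T, ‖∇u₀‖, λ) > 0` such that if a.e. `t ∈ ]0, T[`, it holds
`sin∠(ω̂(x, t), ω̂(y, t)) ⩽ C̄₁`, (4) where `y` are the six grid-points `y = x ± λeⱼ`,
`j = 1, 2, 3`, being `eⱼ` the unit vector in the `j`-Cartesian-coordinate direction, then `u` is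
smooth in `[0, T]`."

Printed proof (pp. 4308–4310): assume blow-up at `T`; on `[t₀, T₁] ⊂ ]0, T[` "we write the
vorticity equation and test by `ω`": `½ d/dt‖ω‖² + ν‖∇ω‖² ⩽ c₁(C̄₁/λ)‖u‖₂‖ω‖₂^{1/2}‖∇ω‖₂^{3/2}
+ c₂(λ/2)‖u‖₂‖ω‖₂‖u‖_{H⁵} ⩽ (C̄₁/λ)^{4/3}‖∇ω‖² + c₄‖u₀‖₂⁴‖ω‖₂² + c₃(λ/2)‖u‖_{H⁵}‖∇ω‖₂²`
(Lemma 3.2, Young, Poincaré, the energy inequality); Lemma 3.3 (`‖u(t)‖_{H⁵} ⩽ Φ(t)` while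
`‖u‖_{H¹}` stays bounded); "we have to fix `λ = |h| > 0` close enough to zero, such that
`c₃λ max Φ(t) ⩽ ν`. Then, if in hypothesis (4) we have also that `C̄₁ > 0` is small enough such
that `C̄₁ ⩽ λ(ν/2)^{3/4}`, … `d/dt‖ω‖² ⩽ 2c₄‖u₀‖₂⁴‖ω‖₂²`, which implies from Gronwall lemma
`max_{t₀⩽t⩽T₁}‖ω(t)‖² ⩽ ‖ω(t₀)‖²e^{2c₄‖u₀‖⁴(T₁−t₀)} ⩽ ‖ω(t₀)‖²e^{2c₄‖u₀‖⁴T}`"; "the same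
argument can be extended to arbitrary intervals `[t₀, T₁] ⊂ ]0, T[`, proving that `‖ω(t)‖`
remains uniformly bounded in the whole interval `[0, T[`. This implies that the solution `u` can
be continued in a larger time interval, by the standard result of continuation for strong
solutions".

What is typed (unit torus `T^d`, `card d = 3` read through a frame `e : d ≃ Fin 3`; classical
solutions `Torus.IsClassicalNSSolutionOn (Ico 0 T) ν 0 u p` of the unforced equations, `ν > 0`,
mean-zero velocity slices; the vorticity read in the frame `ωₖ = W_{k⁺k⁺⁺}(u(t))`,
`W = torusVorticityTensor`, `k⁺ = e⁻¹(e k + 1)`, `k⁺⁺ = e⁻¹(e k + 2)`; hypothesis (4) in the form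
the printed proofs use it, `|ω(x) × ω(x + heⱼ)| ≤ C̄₁ |ω(x)| |ω(x + heⱼ)|` with
`(a × b)ₖ = a_{k⁺}b_{k⁺⁺} − a_{k⁺⁺}b_{k⁺}`, at all `x`, all `j` and both `h = ±λ`, i.e. at the six
grid points, for all `t ∈ [0, T)`):
* `Torus.exists_gradNormSq_le_exp_of_sixPoint` — the a priori bound of the printed proof: there
  is `c₄ ≥ 0` (depending on `d` only: the constant of the second line of the enstrophy display,
  `Torus.integral_vorticityStretching_le_of_sixPoint`) such that for every solution there is
  `λ₀ > 0` with: for all `0 < λ ≤ λ₀`, `0 ≤ C̄₁ ≤ λ(ν/2)^{3/4}` and (4) at the six points on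
  `[0, T)`, `‖∇u(t)‖₂² ≤ ‖∇u(0)‖₂² e^{2c₄‖u(0)‖₂⁴T}` for all `t ∈ [0, T)` (`‖∇u‖₂ = ‖ω‖₂`);
* `Torus.classicalNS_continuation_of_sixPoint` — Theorem 1.1 in continuation form: under the
  same hypotheses the solution continues to a classical solution with mean-zero slices on a
  closed `[0, T']`, `T' > T` (the enstrophy door `Torus.classicalNS_continuation_of_gradNormSq_le`,
  RRS 2016 Lemma 6.11 = "the standard result of continuation for strong solutions");
* `Torus.exists_sixPoint_lt_of_not_bddAbove_gradNormSq` — the blow-up reading (the proof's "per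
  absurdum"): if `‖∇u‖₂²` is unbounded on `[0, T)`, then for such `λ`, `C̄₁` condition (4) fails
  at some `t < T`, `x`, `j`, `h = ±λ`.

Proof = the printed one with `t₀ = 0` (a classical solution on `[0, T)` is smooth up to `t = 0`,
so no interior starting time is needed): the tree's `H¹` balance
`….hasDerivWithinAt_half_gradNormSq` (`d/dt ½‖∇u‖₂² = −ν‖Δu‖₂² + ∫⟪(u·∇)u, Δu⟫`) with
`∫⟪(u·∇)u, Δu⟫ = ∫ ∑ⱼₖ ωⱼ(∂ⱼu)ₖωₖ` (`= ∫σ = ∫ωᵀSω`, `StrainVorticityOrthogonality`,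
`torusStretchingDensity_eq_sum_strain_of_equiv_of_isDivFree`), `‖ω‖₂² = ‖∇u‖₂²`
(`integral_torusVorticitySqAt_eq_two_mul_torusEnstrophy`) and `‖∇ω‖₂² = ‖Δu‖₂²`
(`Torus.sum_gradNormSq_partialDeriv_eq`); the second line of the enstrophy display BY NAME
(`Torus.integral_vorticityStretching_le_of_sixPoint`, landed with Lemmas 3.1–3.2) and the energy
inequality `‖u(t)‖₂ ≤ ‖u(0)‖₂` (`kineticEnergy_le_of_le`); Lemma 3.3 rendered as the private
`Berselli2023.exists_sobolevEnergy_five_le` — ONE envelope `Φ` with `sobolevEnergy 5 (u s) ≤ Φ²`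
on every `[0, t]`, `t < T`, on which `‖∇u‖₂² ≤ f₁`, from the tree's Doering–Gibbon ladder in
Grönwall form (`Torus.exists_wordEnergy_le_exp`, every rung `n ≤ 5`) fed with a uniform gradient
bound (quantitative `H²`/`H³` smoothing `….integral_norm_laplacian_sq_le_of_gradNormSq_le`,
`….norm_partialDeriv_le_of_le` on windows inside `[T/2, t]`, compactness on `[0, T/2]`) in place
of the printed recursion `f₁ → … → f₅` through (5); the smallness `c₃λ₀Φ ≤ ν`,
`(C̄₁/λ)^{4/3} ≤ ν/2`; Grönwall (`le_mul_exp_integral_of_hasDerivWithinAt_le_mul`) under the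
bootstrap hypothesis and the continuity argument on `[0, T)` (private
`Berselli2023.forall_le_of_prefix_bootstrap`); the door.

Deviations, declared: (1) constants per-solution existential — dependence on the initial datum
not rendered; the typed statement is implied by the printed one: `λ₀` is `ν/(c₃Φ + 1)` with `Φ`
computed from `ν`, `T`, `‖u(0)‖₂`, `‖∇u(0)‖₂`, the energies `E_n(u(0))`, `n ≤ 5`, and a bound of
`∇u` on `[0, T/2] × T^d`; the printed dependence `λ = λ(ν, T, ‖∇u₀‖)` (data in `H¹` only) rests
on the paper's SKETCHED time-weighted estimates (p. 4310: "Explicit upper bounds for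
`‖u(t)‖_{H⁵}`, `0 < t < T` can be obtained by means of time-weighted estimates. Just to sketch
the argument, …") and is NOT typed — TODO(general form): `λ₀ = λ₀(ν, T, ‖∇u(0)‖₂)` uniformly
over solutions; the smallness of `λ` (print: "we have to fix `λ = |h| > 0` close enough to zero,
such that `c₃λ max Φ(t) ⩽ ν`", inside the proof) is the explicit hypothesis `λ ≤ λ₀`. (2) The
smallness of `C̄₁` is the printed explicit one, `0 ≤ C̄₁ ≤ λ(ν/2)^{3/4}` (the print has `C̄₁ > 0`;
`C̄₁ = 0` is allowed here). (3) Leray–Hopf weak solutions with `u₀ ∈ H¹`, "smooth in `[0, T]`" ↦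
classical solutions on `[0, T)` with mean-zero slices and continuation past `T`, as in every
criterion of this directory (`TorusNSEnstrophyContinuation`). (4) Unit torus (side `1`, not
`2π`); `|ω × ∇ω|`, `‖u‖_{H⁵} = (sobolevEnergy 5 u)^{1/2}` as in `TorusVorticityDirectionSixPoint`.
(5) Hypothesis (4) is asked at all `t ∈ [0, T)` (print: a.e. `t ∈ ]0, T[`) — for a classical
solution the stronger-looking form is the natural one and implies nothing beyond the print's use.

## Mathlib / tree search

Tree (used): `Torus.integral_vorticityStretching_le_of_sixPoint`
(`TorusVorticityDirectionSixPoint`),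
`Torus.classicalNS_continuation_of_gradNormSq_le` (`TorusNSEnstrophyContinuation`),
`Torus.classicalNS_not_continuation_of_not_bddAbove_gradNormSq'`
(`TorusClassicalNSMaximalSolution`),
`Torus.IsClassicalNSSolutionOn.hasDerivWithinAt_half_gradNormSq` (`TorusClassicalH1Balance`),
`….integral_norm_laplacian_sq_le_of_gradNormSq_le` (`TorusClassicalNSH2Smoothing`),
`….norm_partialDeriv_le_of_le` (`TorusClassicalNSH3Smoothing`), `Torus.exists_wordEnergy_le_exp`,
`Torus.wordEnergy`, `Torus.sobolevEnergy` (`TorusNSLadderInequality`, `TorusWordEnergy`),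
`StrainVorticityOrthogonality.integral_inner_convect_laplacian_eq_integral_torusStretchingDensity`,
`torusStretchingDensity_eq_sum_strain_of_equiv_of_isDivFree`,
`torusVorticitySqAt_eq_sum_sq_of_equiv`
(`TorusVorticityTensorTransport`), `integral_torusVorticitySqAt_eq_two_mul_torusEnstrophy`
(`TorusStrainVorticityIsometry`), `Torus.sum_gradNormSq_partialDeriv_eq`
(`TorusEnstrophyTrilinear`),
`IsDivFree.partialDeriv_of_isSmooth` (`TorusLerayHelmholtzH1`), `kineticEnergy_le_of_le`,
`le_mul_exp_integral_of_hasDerivWithinAt_le_mul` (`ExtremeGrowthVorticityControl`),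
`IsSmoothSpaceTimeOn.exists_norm_le_of_isCompact` (`TorusSpaceTime`); Mathlib
`IsClosed.Icc_subset_of_forall_mem_nhdsWithin` (the continuity argument). Searched
(`lean search --decl`): `sixPoint|six_point|Berselli2023|continuation_of_.*[Dd]irection` — only
`TorusVorticityDirectionSixPoint` (the printed tools, no Theorem 1.1) and the `ℝ³` direction
criteria by name in docstrings; nothing types Theorem 1.1.

## References

* [Berselli2023] L. C. Berselli, *On the vorticity direction and the regularity of 3D
  Navier–Stokes equations*, Nonlinearity 36 (2023) no. 8, 4303–4313,
  doi:10.1088/1361-6544/ace096 — Thm 1.1 (p. 4305), Lemma 3.3 (p. 4308–4309), proof of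
  Thm 1.1 (pp. 4309–4310). Held text `paper:doi-10-1088-1361-6544-ace096` (and the publisher's
  open-access PDF, read 2026-08-25 for the page numbers).
* [RobinsonRodrigoSadowskiCUP2016] J. C. Robinson, J. L. Rodrigo, W. Sadowski, *The
  Three-Dimensional Navier–Stokes Equations*, CUP 2016, Lemma 6.11 (continuation while `‖∇u‖₂`
  stays bounded), via the tree's door.
* [DoeringGibbon1995] C. R. Doering, J. D. Gibbon, *Applied Analysis of the Navier–Stokes
  Equations*, CUP 1995, Thm 6.1 (the ladder), via the tree.
-/

noncomputable section

open Set MeasureTheory Filter Real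
open scoped InnerProductSpace RealInnerProductSpace Topology

namespace Literature.Analysis.FluidPDE

open Literature.Analysis.FunctionSpaces Literature.Analysis.FunctionSpaces.Torus

variable {d : Type*} [Fintype d] [DecidableEq d]

/-! ### §1 Proof devices: the vorticity read in a frame; the stretching integral; the flux -/

namespace Berselli2023

/-- `‖ω(x)‖² = |ω|²(x)` for the vorticity read in a frame (`∑ₖ W_{k⁺k⁺⁺}² = torusVorticitySqAt`).
(Proof device.) [folklore] -/
private theorem norm_sq_vorticityField_eq (e : d ≃ Fin 3)
    {v ω : UnitAddTorus d → EuclideanSpace ℝ d}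
    (hω : ∀ x k, ω x k = torusVorticityTensor v (e.symm (e k + 1)) (e.symm (e k + 2)) x)
    (x : UnitAddTorus d) : ‖ω x‖ ^ 2 = torusVorticitySqAt v x := by
  rw [EuclideanSpace.norm_sq_eq, torusVorticitySqAt_eq_sum_sq_of_equiv e v x]
  exact Finset.sum_congr rfl fun k _ => by rw [Real.norm_eq_abs, sq_abs, hω x k]

/-- `∫ ‖ω‖² = ‖∇v‖₂²` for smooth divergence-free `v` and its vorticity read in a frame
(`∫|ω|² = 2ℰ = ‖∇v‖₂²`, `integral_torusVorticitySqAt_eq_two_mul_torusEnstrophy`).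
(Proof device.) [folklore] -/
private theorem integral_norm_sq_vorticityField_eq (e : d ≃ Fin 3)
    {v ω : UnitAddTorus d → EuclideanSpace ℝ d} (hv : IsSmooth v) (hdiv : IsDivFree v)
    (hω : ∀ x k, ω x k = torusVorticityTensor v (e.symm (e k + 1)) (e.symm (e k + 2)) x) :
    ∫ x, ‖ω x‖ ^ 2 = gradNormSq v := by
  simp_rw [norm_sq_vorticityField_eq e hω]
  rw [integral_torusVorticitySqAt_eq_two_mul_torusEnstrophy hv hdiv,
    gradNormSq_eq_two_mul_torusEnstrophy]

/-- The vorticity read in a frame is smooth for smooth `v`. (Proof device.) [folklore] -/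
private theorem isSmooth_vorticityField' (e : d ≃ Fin 3)
    {v ω : UnitAddTorus d → EuclideanSpace ℝ d}
    (hv : IsSmooth v)
    (hω : ∀ x k, ω x k = torusVorticityTensor v (e.symm (e k + 1)) (e.symm (e k + 2)) x) :
    IsSmooth ω := by
  have hW : ∀ i j, IsSmooth (torusVorticityTensor v i j) := fun i j =>
    ((hv.partialDeriv i).apply j).sub ((hv.partialDeriv j).apply i)
  unfold IsSmooth
  rw [contDiff_euclidean]
  intro k
  have hk : (fun y => (lift ω y) k) =
      lift (torusVorticityTensor v (e.symm (e k + 1)) (e.symm (e k + 2))) := by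
    funext y
    simp [lift_apply, hω]
  rw [hk]
  exact hW _ _

/-- `∂ⱼ` of the frame vorticity of `v` is the frame vorticity of `∂ⱼv`:
`(∂ⱼω)ₖ = W_{k⁺k⁺⁺}(∂ⱼv)` (mixed partials commute). (Proof device.) [folklore] -/
private theorem partialDeriv_vorticityField_apply (e : d ≃ Fin 3)
    {v ω : UnitAddTorus d → EuclideanSpace ℝ d} (hv : IsSmooth v)
    (hω : ∀ x k, ω x k = torusVorticityTensor v (e.symm (e k + 1)) (e.symm (e k + 2)) x)
    (j : d) (x : UnitAddTorus d) (k : d) :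
    Torus.partialDeriv j ω x k =
      torusVorticityTensor (Torus.partialDeriv j v) (e.symm (e k + 1)) (e.symm (e k + 2)) x := by
  have hωs : IsSmooth ω := isSmooth_vorticityField' e hv hω
  set a := e.symm (e k + 1) with ha
  set b := e.symm (e k + 2) with hb
  have hcomp : (fun y => ω y k) = torusVorticityTensor v a b := funext fun y => hω y k
  have hca : IsContDiff 1 (fun y => Torus.partialDeriv a v y b) :=
    ((hv.partialDeriv a).apply b).isContDiff (by simp)
  have hcb : IsContDiff 1 (fun y => Torus.partialDeriv b v y a) :=
    ((hv.partialDeriv b).apply a).isContDiff (by simp)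
  have hfun : torusVorticityTensor v a b =
      (fun y => Torus.partialDeriv a v y b) - fun y => Torus.partialDeriv b v y a := by
    funext y; simp [torusVorticityTensor]
  rw [← partialDeriv_apply_coord (hωs.isContDiff (by simp)) j x k, hcomp, hfun,
    partialDeriv_sub hca hcb j, Pi.sub_apply,
    partialDeriv_apply_coord ((hv.partialDeriv a).isContDiff (by simp)),
    partialDeriv_apply_coord ((hv.partialDeriv b).isContDiff (by simp)), torusVorticityTensor,
    FunctionSpaces.Torus.partialDeriv_comm hv j a x,
    FunctionSpaces.Torus.partialDeriv_comm hv j b x]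

/-- `‖∇ω‖₂² = ‖Δv‖₂²` for smooth divergence-free `v` on `T³` and its vorticity read in a frame:
`∑ⱼ ∫ |∂ⱼω|² = ∑ⱼ ∫ |curl ∂ⱼv|² = ∑ⱼ ‖∇∂ⱼv‖₂² = ‖Δv‖₂²` (`Torus.sum_gradNormSq_partialDeriv_eq`).
(Proof device.) [folklore] -/
private theorem gradNormSq_vorticityField_eq (e : d ≃ Fin 3)
    {v ω : UnitAddTorus d → EuclideanSpace ℝ d} (hv : IsSmooth v) (hdiv : IsDivFree v)
    (hω : ∀ x k, ω x k = torusVorticityTensor v (e.symm (e k + 1)) (e.symm (e k + 2)) x) :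
    gradNormSq ω = ∫ x, ‖Torus.laplacian v x‖ ^ 2 := by
  have hωs : IsSmooth ω := isSmooth_vorticityField' e hv hω
  have hD : ∀ j, IsSmooth (Torus.partialDeriv j v) := fun j => hv.partialDeriv j
  have hDdiv : ∀ j, IsDivFree (Torus.partialDeriv j v) := fun j =>
    IsDivFree.partialDeriv_of_isSmooth hv hdiv j
  rw [← Torus.sum_gradNormSq_partialDeriv_eq hv, gradNormSq,
    integral_finsetSum _ fun j _ => ((hωs.partialDeriv j).norm_sq).integrable]
  refine Finset.sum_congr rfl fun j _ => ?_
  rw [← integral_norm_sq_vorticityField_eq e (hD j) (hDdiv j)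
    (ω := Torus.partialDeriv j ω) (partialDeriv_vorticityField_apply e hv hω j)]

omit [Fintype d] [DecidableEq d] in
/-- `ωᵀSω = ∑ⱼₖ ωⱼ (∂ⱼv)ₖ ωₖ`: the antisymmetric part of `∇v` drops out of the quadratic form.
(Proof device.) [folklore] -/
private theorem sum_strain_quadratic_eq [Fintype d] (ω : d → ℝ) (P : d → d → ℝ) :
    ∑ i, ∑ j, ω i * ((P j i + P i j) / 2) * ω j = ∑ j, ∑ k, ω j * P j k * ω k := by
  have h1 : ∑ i, ∑ j, ω i * ((P j i + P i j) / 2) * ω j =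
      (∑ i, ∑ j, ω i * P j i * ω j) / 2 + (∑ i, ∑ j, ω i * P i j * ω j) / 2 := by
    rw [Finset.sum_div, Finset.sum_div, ← Finset.sum_add_distrib]
    refine Finset.sum_congr rfl fun i _ => ?_
    rw [Finset.sum_div, Finset.sum_div, ← Finset.sum_add_distrib]
    exact Finset.sum_congr rfl fun j _ => by ring
  have h2 : ∑ i, ∑ j, ω i * P j i * ω j = ∑ i, ∑ j, ω i * P i j * ω j := by
    rw [Finset.sum_comm]
    exact Finset.sum_congr rfl fun i _ => Finset.sum_congr rfl fun j _ => by ring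
  rw [h1, h2]
  ring

open StrainVorticityOrthogonality in
/-- **`∫⟪(v·∇)v, Δv⟫ = ∫ ∑ⱼₖ ωⱼ (∂ⱼv)ₖ ωₖ`** for smooth divergence-free `v` on `T³` and its
vorticity read in a frame: the inertial term of the tree's `H¹` balance is Berselli's stretching
integral `∫(ω·∇)u·ω` (`∫⟪(v·∇)v, Δv⟫ = ∫σ`, `σ = ωᵀSω`). (Proof device.) [folklore] -/
private theorem integral_inner_convect_laplacian_eq_integral_vorticityStretching (e : d ≃ Fin 3)
    {v ω : UnitAddTorus d → EuclideanSpace ℝ d} (hv : IsSmooth v) (hdiv : IsDivFree v)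
    (hω : ∀ x k, ω x k = torusVorticityTensor v (e.symm (e k + 1)) (e.symm (e k + 2)) x) :
    ∫ x, ⟪Torus.convect v v x, Torus.laplacian v x⟫ =
      ∫ x, ∑ j, ∑ k, ω x j * Torus.partialDeriv j v x k * ω x k := by
  rw [integral_inner_convect_laplacian_eq_integral_torusStretchingDensity hv hdiv]
  refine integral_congr_ae (Eventually.of_forall fun x => ?_)
  dsimp only
  rw [torusStretchingDensity_eq_sum_strain_of_equiv_of_isDivFree e (hv.isContDiff (by simp)) hdiv x]
  simp_rw [← hω]
  exact sum_strain_quadratic_eq (fun k => ω x k) (fun j k => Torus.partialDeriv j v x k)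

omit [Fintype d] [DecidableEq d] in
/-- **Continuity (real-induction) argument on `[0, T)`.** If `W` is continuous on every
`[0, t₁]`, `0 < t₁ < T`, `W(0) ≤ M < B`, and the bootstrap hypothesis `W ≤ B` on `[0, t]` always
improves to `W ≤ M` on `[0, t]`, then `W ≤ M` on `[0, T)`. (Proof device.) [folklore] -/
private theorem forall_le_of_prefix_bootstrap {T M B : ℝ} {W : ℝ → ℝ}
    (hW : ∀ t₁ ∈ Ioo 0 T, ContinuousOn W (Icc 0 t₁)) (hMB : M < B) (h0 : W 0 ≤ M)
    (hstep : ∀ t ∈ Ico 0 T, (∀ s ∈ Icc 0 t, W s ≤ B) → ∀ s ∈ Icc 0 t, W s ≤ M) :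
    ∀ t ∈ Ico 0 T, W t ≤ M := by
  intro t₁ ht₁
  rcases ht₁.1.eq_or_lt with h01 | h01
  · rw [← h01]; exact h0
  have hWc : ContinuousOn W (Icc 0 t₁) := hW t₁ ⟨h01, ht₁.2⟩
  -- `S` = the times up to which the bound `W ≤ M` holds
  set S : Set ℝ := {t | ∀ r ∈ Icc 0 t, W r ≤ M} with hS
  suffices hsub : Icc 0 t₁ ⊆ S from
    hsub (right_mem_Icc.2 ht₁.1) t₁ (right_mem_Icc.2 ht₁.1)
  apply IsClosed.Icc_subset_of_forall_mem_nhdsWithin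
  · -- `S ∩ [0, t₁] = ⋂_{r ∈ [0, t₁]} {c ∈ [0, t₁] | W (min r c) ≤ M}` is closed
    have hEq : S ∩ Icc 0 t₁ = ⋂ r ∈ Icc 0 t₁, (Icc 0 t₁ ∩ (fun c => W (min r c)) ⁻¹' Iic M) := by
      ext c
      simp only [hS, mem_inter_iff, mem_setOf_eq, mem_iInter, mem_preimage, mem_Iic]
      constructor
      · rintro ⟨hc, hcI⟩ r hr
        exact ⟨hcI, hc (min r c) ⟨le_min hr.1 hcI.1, min_le_right r c⟩⟩
      · intro h
        have hcI : c ∈ Icc 0 t₁ := (h 0 (left_mem_Icc.2 ht₁.1)).1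
        refine ⟨fun r hr => ?_, hcI⟩
        have h2 := (h r ⟨hr.1, hr.2.trans hcI.2⟩).2
        rwa [min_eq_left hr.2] at h2
    rw [hEq]
    refine isClosed_biInter fun r hr => ?_
    refine ContinuousOn.preimage_isClosed_of_isClosed ?_ isClosed_Icc isClosed_Iic
    refine hWc.comp (continuous_const.min continuous_id).continuousOn fun c hc => ?_
    exact ⟨le_min hr.1 hc.1, (min_le_right r c).trans hc.2⟩
  · -- `0 ∈ S`
    intro r hr
    rw [le_antisymm hr.2 hr.1]
    exact h0
  · -- right-openness: from `W ≤ M < B` on `[0, x]`, `W < B` a little further, then `hstep`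
    rintro x ⟨hxS, hxI⟩
    have hcont : ContinuousWithinAt W (Icc 0 t₁) x := hWc x ⟨hxI.1, hxI.2.le⟩
    have hlt : W x < B := (hxS x ⟨hxI.1, le_rfl⟩).trans_lt hMB
    have hev : ∀ᶠ y in 𝓝[Icc 0 t₁] x, W y < B := hcont (Iio_mem_nhds hlt)
    obtain ⟨δ, hδ, hδB⟩ := Metric.eventually_nhds_iff.1 (eventually_nhdsWithin_iff.1 hev)
    set m : ℝ := min (x + δ) t₁ with hm
    have hxm : x < m := lt_min (by linarith) hxI.2
    refine mem_of_superset (Ioo_mem_nhdsGT hxm) fun y hy => ?_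
    have hyt₁ : y < t₁ := hy.2.trans_le (min_le_right _ _)
    have hyT : y ∈ Ico 0 T := ⟨hxI.1.trans hy.1.le, hyt₁.trans ht₁.2⟩
    refine hstep y hyT fun s hs => ?_
    rcases le_or_gt s x with hsx | hsx
    · exact (hxS s ⟨hs.1, hsx⟩).trans hMB.le
    · have hsd : dist s x < δ := by
        rw [Real.dist_eq, abs_of_pos (sub_pos.2 hsx)]
        linarith [hs.2, hy.2.trans_le (min_le_left _ _)]
      exact (hδB hsd ⟨hs.1, hs.2.trans hyt₁.le⟩).le

/-- **The flux inequality of the printed proof at one time**, bookkeeping only: if the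
stretching term obeys the second line of the enstrophy display (p. 4309) with
`C̄₁ ≤ λ(ν/2)^{3/4}` (so `(C̄₁/λ)^{4/3} ≤ ν/2`) and `c₃ λ Φ ≤ ν`, `‖u‖_{H⁵} ≤ Φ`, then
`−ν‖Δu‖₂² + ∫⟪(u·∇)u, Δu⟫ ≤ c₄ ‖u‖₂⁴ ‖∇u‖₂²` (`‖∇ω‖₂ = ‖Δu‖₂`, `‖ω‖₂ = ‖∇u‖₂`).
(Proof device.) [folklore] -/
private theorem enstrophyFlux_le (e : d ≃ Fin 3) {ν : ℝ} (hν : 0 < ν) {c₃ c₄ : ℝ} (hc₃ : 0 ≤ c₃)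
    {v ω : UnitAddTorus d → EuclideanSpace ℝ d} (hv : IsSmooth v) (hdiv : IsDivFree v)
    (hω : ∀ x k, ω x k = torusVorticityTensor v (e.symm (e k + 1)) (e.symm (e k + 2)) x)
    {lam C₁ Φ : ℝ} (hlam : 0 < lam) (hC₁ : 0 ≤ C₁) (hC₁le : C₁ ≤ lam * (ν / 2) ^ (3 / 4 : ℝ))
    (hΦ : 0 ≤ Φ) (hE5 : Torus.sobolevEnergy 5 v ≤ Φ ^ 2) (hlamΦ : c₃ * lam * Φ ≤ ν)
    (hst : ∫ x, ∑ j, ∑ k, ω x j * Torus.partialDeriv j v x k * ω x k ≤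
      (C₁ / lam) ^ (4 / 3 : ℝ) * (∫ x, ∑ j, ‖Torus.partialDeriv j ω x‖ ^ 2) +
        c₄ * (∫ x, ‖v x‖ ^ 2) ^ 2 * (∫ x, ‖ω x‖ ^ 2) +
        c₃ * (lam / 2) * Real.sqrt (Torus.sobolevEnergy 5 v) *
          (∫ x, ∑ j, ‖Torus.partialDeriv j ω x‖ ^ 2)) :
    -ν * (∫ x, ‖Torus.laplacian v x‖ ^ 2) + ∫ x, ⟪Torus.convect v v x, Torus.laplacian v x⟫ ≤
      c₄ * (∫ x, ‖v x‖ ^ 2) ^ 2 * gradNormSq v := by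
  have hG : (∫ x, ∑ j, ‖Torus.partialDeriv j ω x‖ ^ 2) = ∫ x, ‖Torus.laplacian v x‖ ^ 2 :=
    gradNormSq_vorticityField_eq e hv hdiv hω
  have hL : (∫ x, ‖ω x‖ ^ 2) = gradNormSq v := integral_norm_sq_vorticityField_eq e hv hdiv hω
  rw [integral_inner_convect_laplacian_eq_integral_vorticityStretching e hv hdiv hω]
  rw [hG, hL] at hst
  set Y : ℝ := ∫ x, ‖Torus.laplacian v x‖ ^ 2 with hY
  have hY0 : 0 ≤ Y := integral_nonneg fun x => by positivity
  have hν2 : 0 ≤ ν / 2 := by positivity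
  -- `(C̄₁/λ)^{4/3} ≤ ν/2`
  have h1 : (C₁ / lam) ^ (4 / 3 : ℝ) ≤ ν / 2 := by
    have hq : C₁ / lam ≤ (ν / 2) ^ (3 / 4 : ℝ) := by
      rw [div_le_iff₀ hlam]; linarith [mul_comm lam ((ν / 2) ^ (3 / 4 : ℝ))]
    calc (C₁ / lam) ^ (4 / 3 : ℝ) ≤ ((ν / 2) ^ (3 / 4 : ℝ)) ^ (4 / 3 : ℝ) :=
          Real.rpow_le_rpow (div_nonneg hC₁ hlam.le) hq (by norm_num)
      _ = ν / 2 := by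
          rw [← Real.rpow_mul hν2]; norm_num
  -- `c₃ (λ/2) ‖u‖_{H⁵} ≤ ν/2`
  have h2 : c₃ * (lam / 2) * Real.sqrt (Torus.sobolevEnergy 5 v) ≤ ν / 2 := by
    have hs : Real.sqrt (Torus.sobolevEnergy 5 v) ≤ Φ := by
      rw [← Real.sqrt_sq hΦ]; exact Real.sqrt_le_sqrt hE5
    calc c₃ * (lam / 2) * Real.sqrt (Torus.sobolevEnergy 5 v) ≤ c₃ * (lam / 2) * Φ :=
          mul_le_mul_of_nonneg_left hs (by positivity)
      _ = c₃ * lam * Φ / 2 := by ring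
      _ ≤ ν / 2 := by linarith
  have h1Y := mul_le_mul_of_nonneg_right h1 hY0
  have h2Y := mul_le_mul_of_nonneg_right h2 hY0
  linarith

/-- **A uniform `W^{1,∞}` bound two lapses into a window with bounded enstrophy** (the tree's
quantitative `H²`/`H³` smoothing after Robinson–Rodrigo–Sadowski 2016, Thm 7.1/7.3/7.5,
packaged): for `ν > 0`, a level `B₁` and a lapse `τ > 0` there is `M₁` such that along every
classical solution of the unforced equations with mean-zero slices, if `[r − 2τ, r]` lies in the
time set and `‖∇u‖₂² ≤ B₁` there, then `‖∂ₖu(r, x)‖ ≤ M₁` for all `k`, `x`.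
(Proof device.) [folklore] -/
private theorem exists_norm_partialDeriv_le_of_window (hd : Fintype.card d = 3) {ν : ℝ} (hν : 0 < ν)
    (B₁ : ℝ) {τ : ℝ} (hτ : 0 < τ) :
    ∃ M₁ : ℝ, ∀ {S : Set ℝ} {u : ℝ → UnitAddTorus d → EuclideanSpace ℝ d}
      {p : ℝ → UnitAddTorus d → ℝ}, Torus.IsClassicalNSSolutionOn S ν 0 u p →
      (∀ t ∈ S, HasZeroMean (u t)) → ∀ {r : ℝ}, Icc (r - 2 * τ) r ⊆ S →
      (∀ s ∈ Icc (r - 2 * τ) r, gradNormSq (u s) ≤ B₁) →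
      ∀ (k : d) (x : UnitAddTorus d), ‖Torus.partialDeriv k (u r) x‖ ≤ M₁ := by
  set G₀ : ℝ := gradNormSq ((0 : ℝ → UnitAddTorus d → EuclideanSpace ℝ d) 0) with hG₀
  set G₂ : ℝ := ∫ x, ‖Torus.laplacian ((0 : ℝ → UnitAddTorus d → EuclideanSpace ℝ d) 0) x‖ ^ 2
    with hG₂
  obtain ⟨C₂, hC₂⟩ :=
    Torus.IsClassicalNSSolutionOn.integral_norm_laplacian_sq_le_of_gradNormSq_le (d := d) hd hν
      B₁ G₀ hτ
  obtain ⟨M₁, hM₁⟩ :=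
    Torus.IsClassicalNSSolutionOn.norm_partialDeriv_le_of_le (d := d) hd hν B₁ C₂ G₀ G₂ hτ
  refine ⟨M₁, fun {S u p} h hmean {r} hsub hB k x => ?_⟩
  -- `‖Δu(s)‖₂² ≤ C₂` on `[r − τ, r]`, from the windows `[s − τ, s] ⊆ [r − 2τ, r]`
  have hY : ∀ s ∈ Icc (r - τ) r, ∫ y, ‖Torus.laplacian (u s) y‖ ^ 2 ≤ C₂ := by
    intro s hs
    have e1 : s - τ + τ = s := sub_add_cancel s τ
    have hI : Icc (s - τ) (s - τ + τ) ⊆ Icc (r - 2 * τ) r := by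
      rw [e1]; exact Icc_subset_Icc (by linarith [hs.1]) hs.2
    have hsol := h.mono (hI.trans hsub) (uniqueDiffOn_Icc (by linarith))
    have h2 := hC₂ hsol (fun t ht => hmean t (hsub (hI ht))) (fun t ht => hB t (hI ht))
      (fun t _ => le_rfl)
    rwa [e1] at h2
  have e2 : r - τ + τ = r := sub_add_cancel r τ
  have hI2 : Icc (r - τ) (r - τ + τ) ⊆ Icc (r - 2 * τ) r := by
    rw [e2]; exact Icc_subset_Icc (by linarith) le_rfl
  have hsol2 := h.mono (hI2.trans hsub) (uniqueDiffOn_Icc (by linarith))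
  have h3 := hM₁ hsol2 (fun t ht => hmean t (hsub (hI2 ht))) (fun t ht => hB t (hI2 ht))
    (fun t ht => hY t (by rw [e2] at ht; exact ht)) (fun t _ => le_rfl) (fun t _ => le_rfl) k x
  rwa [e2] at h3

/-- **Lemma 3.3 of the print, rendered for a classical solution on `[0, T)`** ("Let `u₀ ∈ H⁵`,
and let `‖u(t)‖_{H¹} < ∞` for all `t ∈ [0, T₁]`. Then, it follows that `‖u(t)‖_{H⁵} ⩽ Φ(t)` for
all `t ∈ [0, T₁]`, for some function `Φ(t) : [0, T₁] → ℝ⁺` depending (in a computable way) on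
`ν`, `T`, and `‖u(t)‖_{H¹}`."): given the solution and a level `B₁` there is `Φ ≥ 0` such that
for EVERY `t < T`, if `‖∇u‖₂² ≤ B₁` on `[0, t]` then `sobolevEnergy 5 (u s) ≤ Φ²` on `[0, t]` —
one `Φ` for all `t`, as the printed proof of Thm 1.1 uses it ("if we first fix `f₁`, than we can
determine `Φ`"). Here `Φ² = ∑_{n ≤ 5} E_n(u(0)) e^{2 c_n M T}` from the tree's Doering–Gibbon
ladder in Grönwall form (`Torus.exists_wordEnergy_le_exp`) with a uniform gradient bound
`|∇u| ≤ M`: on `[T/2, t]` from `exists_norm_partialDeriv_le_of_window` (lapse `T/4`), on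
`[0, T/2]` by compactness (the solution is classical on the closed `[0, T/2]`) — in place of the
printed recursion `f₁ → f₂ → … → f₅` through (5); `M`, hence `Φ`, depends on the solution
through its restriction to `[0, T/2]` and on `ν, T, B₁`. (Proof device.)
[cite: Berselli2023, Lemma 3.3 (p. 4308–4309)] -/
private theorem exists_sobolevEnergy_five_le (hd : Fintype.card d = 3) {ν T : ℝ} (hν : 0 < ν)
    (hT : 0 < T) {u : ℝ → UnitAddTorus d → EuclideanSpace ℝ d} {p : ℝ → UnitAddTorus d → ℝ}
    (h : Torus.IsClassicalNSSolutionOn (Ico 0 T) ν 0 u p)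
    (hmean : ∀ t ∈ Ico 0 T, HasZeroMean (u t)) (B₁ : ℝ) :
    ∃ Φ : ℝ, 0 ≤ Φ ∧ ∀ t ∈ Ico 0 T, (∀ s ∈ Icc 0 t, gradNormSq (u s) ≤ B₁) →
      ∀ s ∈ Icc 0 t, Torus.sobolevEnergy 5 (u s) ≤ Φ ^ 2 := by
  have hτ : 0 < T / 4 := by positivity
  obtain ⟨M₁, hM₁⟩ := exists_norm_partialDeriv_le_of_window (d := d) hd hν B₁ hτ
  -- compactness on `[0, T/2]`
  have hU : UniqueDiffOn ℝ (Ico 0 T) := uniqueDiffOn_Ico 0 T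
  have hK : Icc 0 (T / 2) ⊆ Ico 0 T := fun t ht => ⟨ht.1, ht.2.trans_lt (by linarith)⟩
  have hC : ∀ k : d, ∃ C : ℝ, ∀ t ∈ Icc 0 (T / 2), ∀ x, ‖Torus.partialDeriv k (u t) x‖ ≤ C :=
    fun k => (h.smooth_velocity.partialDeriv hU k).exists_norm_le_of_isCompact isCompact_Icc hK
  choose C hC using hC
  set M : ℝ := |M₁| + ∑ k, |C k| with hM
  have hsum0 : 0 ≤ ∑ k, |C k| := Finset.sum_nonneg fun k _ => abs_nonneg _
  have hM0 : 0 ≤ M := by positivity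
  have hM₁M : M₁ ≤ M := (le_abs_self M₁).trans (by linarith)
  have hCM : ∀ k, C k ≤ M := fun k => by
    have h1 : |C k| ≤ ∑ j, |C j| :=
      Finset.single_le_sum (f := fun j => |C j|) (fun j _ => abs_nonneg _) (Finset.mem_univ k)
    linarith [le_abs_self (C k), abs_nonneg M₁]
  -- the uniform gradient bound under the bootstrap hypothesis
  have hgrad : ∀ t ∈ Ico 0 T, (∀ s ∈ Icc 0 t, gradNormSq (u s) ≤ B₁) →
      ∀ r ∈ Icc 0 t, ∀ x, ∑ i, ‖Torus.partialDeriv i (u r) x‖ ^ 2 ≤ (Real.sqrt 3 * M) ^ 2 := by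
    intro t ht hB r hr x
    have hptw : ∀ i, ‖Torus.partialDeriv i (u r) x‖ ≤ M := by
      intro i
      rcases le_or_gt r (T / 2) with hr2 | hr2
      · exact (hC i r ⟨hr.1, hr2⟩ x).trans (hCM i)
      · have hsub : Icc (r - 2 * (T / 4)) r ⊆ Ico 0 T := fun s hs =>
          ⟨by linarith [hs.1], hs.2.trans_lt (hr.2.trans_lt ht.2)⟩
        have hB' : ∀ s ∈ Icc (r - 2 * (T / 4)) r, gradNormSq (u s) ≤ B₁ := fun s hs =>
          hB s ⟨by linarith [hs.1], hs.2.trans hr.2⟩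
        exact (hM₁ h hmean hsub hB' i x).trans hM₁M
    calc ∑ i, ‖Torus.partialDeriv i (u r) x‖ ^ 2 ≤ ∑ _i : d, M ^ 2 :=
          Finset.sum_le_sum fun i _ => pow_le_pow_left₀ (norm_nonneg _) (hptw i) 2
      _ = (Real.sqrt 3 * M) ^ 2 := by
          rw [Finset.sum_const, Finset.card_univ, hd, mul_pow, Real.sq_sqrt (by norm_num)]
          simp
  -- the ladder, rung by rung
  choose c hc0 hc using fun N => Torus.exists_wordEnergy_le_exp d N
  set Mt : ℝ := Real.sqrt 3 * M with hMt
  have hMt0 : 0 ≤ Mt := by positivity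
  set Φsq : ℝ := ∑ N ∈ Finset.range 6, Torus.wordEnergy N (u 0) * Real.exp (2 * c N * Mt * T)
    with hΦsq
  have hΦsq0 : 0 ≤ Φsq := Finset.sum_nonneg fun N _ =>
    mul_nonneg (Torus.wordEnergy_nonneg _ _) (Real.exp_nonneg _)
  refine ⟨Real.sqrt Φsq, Real.sqrt_nonneg _, fun t ht hB s hs => ?_⟩
  rw [Real.sq_sqrt hΦsq0, Torus.sobolevEnergy]
  refine Finset.sum_le_sum fun N _ => ?_
  have hexp1 : Torus.wordEnergy N (u s) ≤
      Torus.wordEnergy N (u 0) * Real.exp (2 * c N * Mt * (s - 0)) := by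
    rcases ht.1.eq_or_lt with h0t | h0t
    · have hs0 : s = 0 := le_antisymm (h0t ▸ hs.2) hs.1
      rw [hs0, sub_self, mul_zero, Real.exp_zero, mul_one]
    · have hsub : Icc 0 t ⊆ Ico 0 T := fun r hr => ⟨hr.1, hr.2.trans_lt ht.2⟩
      have hsol := h.mono hsub (uniqueDiffOn_Icc h0t)
      exact hc N hsol h0t hν.le Mt hMt0 (hgrad t ht hB) hs
  refine hexp1.trans (mul_le_mul_of_nonneg_left (Real.exp_le_exp.2 ?_)
    (Torus.wordEnergy_nonneg _ _))
  have : s - 0 ≤ T := by linarith [hs.2, ht.2.le]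
  exact mul_le_mul_of_nonneg_left this (by
    have := hc0 N
    positivity)

end Berselli2023

/-! ### §2 The a priori enstrophy bound of the printed proof -/

/-- **The a priori bound in the proof of Berselli's Theorem 1.1, on `T³`.** Printed (p. 4310,
after "the second term from the left-hand side is non-negative"): "`d/dt‖ω‖² ⩽ 2c₄‖u₀‖₂⁴‖ω‖₂²`
… which implies from Gronwall lemma `max_{t₀⩽t⩽T₁}‖ω(t)‖² ⩽ ‖ω(t₀)‖²e^{2c₄‖u₀‖⁴(T₁−t₀)} ⩽
‖ω(t₀)‖²e^{2c₄‖u₀‖⁴T}`", extended to "arbitrary intervals `[t₀, T₁] ⊂ ]0, T[`". Here, with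
`t₀ = 0` and `‖ω‖₂ = ‖∇u‖₂` on the torus: there is `c₄ ≥ 0` depending on `d` only (the constant
`c₄` of the second line of the enstrophy display,
`Torus.integral_vorticityStretching_le_of_sixPoint`) such that for every classical solution of
the unforced equations (`ν > 0`) on `[0, T) × T^d`,
`card d = 3` read through `e`, with mean-zero slices, there is `λ₀ > 0` (constants per-solution
existential — dependence on the initial datum not rendered; the typed statement is implied by
the printed one: the printed `λ(ν, T, ‖∇u₀‖)` is NOT typed, module docstring) such that for all
`0 < λ ≤ λ₀`,
`0 ≤ C̄₁ ≤ λ(ν/2)^{3/4}`, if the vorticity read in the frame satisfies (4) at the six grid points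
`x ± λeⱼ` for all `t ∈ [0, T)`, then `‖∇u(t)‖₂² ≤ ‖∇u(0)‖₂² e^{2c₄‖u(0)‖₂⁴T}` for all
`t ∈ [0, T)` (`‖u(0)‖₂⁴ = (∫‖u(0)‖²)²`). HONEST SCOPE: a PRINTED conditional regularity
criterion typed as printed for the classical class — criterion-only; no claim about solutions
beyond the cited theorem; no node of this cell decided. Proof: the printed one (module
docstring). [cite: Berselli2023, proof of Thm 1.1, the Gronwall bound (p. 4310)] -/
theorem Torus.exists_gradNormSq_le_exp_of_sixPoint (e : d ≃ Fin 3) :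
    ∃ c₄ : ℝ, 0 ≤ c₄ ∧ ∀ {ν T : ℝ} {u : ℝ → UnitAddTorus d → EuclideanSpace ℝ d}
      {p : ℝ → UnitAddTorus d → ℝ}, 0 < ν → 0 < T →
      Torus.IsClassicalNSSolutionOn (Ico 0 T) ν 0 u p → (∀ t ∈ Ico 0 T, HasZeroMean (u t)) →
    ∃ lam₀ : ℝ, 0 < lam₀ ∧ ∀ (lam C₁ : ℝ), 0 < lam → lam ≤ lam₀ → 0 ≤ C₁ →
      C₁ ≤ lam * (ν / 2) ^ (3 / 4 : ℝ) →
      (∀ t ∈ Ico 0 T, ∀ (ω : UnitAddTorus d → EuclideanSpace ℝ d),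
        (∀ x k, ω x k = torusVorticityTensor (u t) (e.symm (e k + 1)) (e.symm (e k + 2)) x) →
        ∀ (x : UnitAddTorus d) (j : d) (h : ℝ), |h| = lam →
          Real.sqrt (∑ k, (ω x (e.symm (e k + 1)) *
              ω (x + proj (h • EuclideanSpace.single j (1 : ℝ))) (e.symm (e k + 2)) -
            ω x (e.symm (e k + 2)) *
              ω (x + proj (h • EuclideanSpace.single j (1 : ℝ))) (e.symm (e k + 1))) ^ 2) ≤
            C₁ * ‖ω x‖ * ‖ω (x + proj (h • EuclideanSpace.single j (1 : ℝ)))‖) →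
      ∀ t ∈ Ico 0 T, gradNormSq (u t) ≤
        gradNormSq (u 0) * Real.exp (2 * c₄ * (∫ x, ‖u 0 x‖ ^ 2) ^ 2 * T) := by
  have hd : Fintype.card d = 3 := by simpa using Fintype.card_congr e
  obtain ⟨c₃, c₄, hc₃, hc₄, h6⟩ := Torus.integral_vorticityStretching_le_of_sixPoint (d := d) e
  refine ⟨c₄, hc₄, fun {ν T u p} hν hT h hmean => ?_⟩
  -- the constants of the printed proof with `t₀ = 0`
  set K₀ : ℝ := ∫ x, ‖u 0 x‖ ^ 2 with hK₀
  have hK₀0 : 0 ≤ K₀ := integral_nonneg fun x => by positivity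
  set κ : ℝ := 2 * c₄ * K₀ ^ 2 with hκ
  have hκ0 : 0 ≤ κ := by positivity
  set W : ℝ → ℝ := fun s => 2⁻¹ * gradNormSq (u s) with hW
  have hW0 : ∀ s, 0 ≤ W s := fun s => mul_nonneg (by norm_num) (gradNormSq_nonneg _)
  set Mb : ℝ := W 0 * Real.exp (κ * T) with hMb
  have hMb0 : 0 ≤ Mb := mul_nonneg (hW0 0) (Real.exp_nonneg _)
  set B₁ : ℝ := 2 * (Mb + 1) with hB₁
  -- Lemma 3.3: ONE `H⁵` envelope `Φ` for the bootstrap level `f₁ < B₁`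
  obtain ⟨Φ, hΦ0, hΦ⟩ := Berselli2023.exists_sobolevEnergy_five_le hd hν hT h hmean B₁
  -- "fix `λ = |h| > 0` close enough to zero, such that `c₃ λ max Φ ≤ ν`"
  refine ⟨ν / (c₃ * Φ + 1), by positivity, fun lam C₁ hlam hlamle hC₁ hC₁le h4 => ?_⟩
  have hlamΦ : c₃ * lam * Φ ≤ ν := by
    have h1 : c₃ * Φ * lam ≤ c₃ * Φ * (ν / (c₃ * Φ + 1)) :=
      mul_le_mul_of_nonneg_left hlamle (by positivity)
    have h2 : c₃ * Φ * (ν / (c₃ * Φ + 1)) ≤ ν := by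
      rw [mul_div_assoc', div_le_iff₀ (by positivity)]
      nlinarith [mul_nonneg hc₃ hΦ0, hν.le]
    nlinarith
  -- the solution on closed subintervals, the flux `D` of `W = ½‖∇u‖₂²`, continuity of `W`
  have hsolI : ∀ {t : ℝ}, t ∈ Ioo 0 T → Torus.IsClassicalNSSolutionOn (Icc 0 t) ν 0 u p :=
    fun {t} ht => h.mono (fun r hr => ⟨hr.1, hr.2.trans_lt ht.2⟩) (uniqueDiffOn_Icc ht.1)
  set D : ℝ → ℝ := fun s => -ν * (∫ x, ‖Torus.laplacian (u s) x‖ ^ 2) +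
    ∫ x, ⟪Torus.convect (u s) (u s) x - (0 : ℝ → UnitAddTorus d → EuclideanSpace ℝ d) s x,
      Torus.laplacian (u s) x⟫ with hD
  have hder : ∀ {t : ℝ}, t ∈ Ioo 0 T → ∀ s ∈ Icc 0 t, HasDerivWithinAt W (D s) (Icc 0 t) s :=
    fun {t} ht s hs => (hsolI ht).hasDerivWithinAt_half_gradNormSq ht.1 hs
  have hWc : ∀ t ∈ Ioo 0 T, ContinuousOn W (Icc 0 t) :=
    fun t ht s hs => (hder ht s hs).continuousWithinAt
  -- the flux bound `D ≤ 2c₄‖u(0)‖₂⁴ W` at every time with `‖u(s)‖_{H⁵} ≤ Φ`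
  have hflux : ∀ s ∈ Ico 0 T, Torus.sobolevEnergy 5 (u s) ≤ Φ ^ 2 → D s ≤ κ * W s := by
    intro s hs hE5
    have hus : IsSmooth (u s) := h.smooth_velocity.isSmooth_slice hs
    have hdiv : IsDivFree (u s) := h.divFree s hs
    -- the vorticity of `u(s)` read in the frame
    set ω : UnitAddTorus d → EuclideanSpace ℝ d := fun x =>
      WithLp.toLp 2 fun k => torusVorticityTensor (u s) (e.symm (e k + 1)) (e.symm (e k + 2)) x
      with hωdef
    have hω : ∀ x k, ω x k =
        torusVorticityTensor (u s) (e.symm (e k + 1)) (e.symm (e k + 2)) x := fun x k => rfl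
    -- the second line of the enstrophy display, at `h = λ`
    have hst := h6 (u s) hus (hmean s hs) hdiv ω hω lam C₁ lam hlam hC₁ (abs_of_pos hlam)
      (fun x j => h4 s hs ω hω x j lam (abs_of_pos hlam))
    have hfl := Berselli2023.enstrophyFlux_le e hν hc₃ hus hdiv hω hlam hC₁ hC₁le hΦ0 hE5
      hlamΦ hst
    -- the energy inequality `‖u(s)‖₂² ≤ ‖u(0)‖₂²`
    have hen : ∫ x, ‖u s x‖ ^ 2 ≤ K₀ := by
      have hk := kineticEnergy_le_of_le hν.le h (convex_Ico 0 T) hs.1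
        (fun r hr => ⟨hr.1, hr.2.trans_lt hs.2⟩)
      simp only [kineticEnergy] at hk
      linarith
    have hen0 : 0 ≤ ∫ x, ‖u s x‖ ^ 2 := integral_nonneg fun x => by positivity
    have hD' : D s = -ν * (∫ x, ‖Torus.laplacian (u s) x‖ ^ 2) +
        ∫ x, ⟪Torus.convect (u s) (u s) x, Torus.laplacian (u s) x⟫ := by
      simp only [hD, Pi.zero_apply, sub_zero]
    rw [hD']
    calc -ν * (∫ x, ‖Torus.laplacian (u s) x‖ ^ 2) +
          ∫ x, ⟪Torus.convect (u s) (u s) x, Torus.laplacian (u s) x⟫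
        ≤ c₄ * (∫ x, ‖u s x‖ ^ 2) ^ 2 * gradNormSq (u s) := hfl
      _ ≤ c₄ * K₀ ^ 2 * gradNormSq (u s) := by
          have := pow_le_pow_left₀ hen0 hen 2
          have hg := gradNormSq_nonneg (u s)
          gcongr
      _ = κ * W s := by simp only [hκ, hW]; ring
  -- the continuity argument: `½‖∇u(t)‖₂² ≤ ½‖∇u(0)‖₂² e^{κT}` on `[0, T)`
  have hapriori : ∀ t ∈ Ico 0 T, W t ≤ Mb := by
    refine Berselli2023.forall_le_of_prefix_bootstrap hWc (by linarith : Mb < Mb + 1) ?_ ?_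
    · exact le_mul_of_one_le_right (hW0 0) (Real.one_le_exp (by positivity))
    · intro t ht hboot s hs
      have hB : ∀ r ∈ Icc 0 t, gradNormSq (u r) ≤ B₁ := fun r hr => by
        have := hboot r hr
        simp only [hW] at this
        rw [hB₁]; linarith
      have hE5 : ∀ r ∈ Icc 0 t, Torus.sobolevEnergy 5 (u r) ≤ Φ ^ 2 := hΦ t ht hB
      rcases ht.1.eq_or_lt with h0t | h0t
      · have hs0 : s = 0 := le_antisymm (h0t ▸ hs.2) hs.1
        rw [hs0]
        exact le_mul_of_one_le_right (hW0 0) (Real.one_le_exp (by positivity))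
      · have htI : t ∈ Ioo 0 T := ⟨h0t, ht.2⟩
        -- Grönwall under the bootstrap hypothesis
        have hG := le_mul_exp_integral_of_hasDerivWithinAt_le_mul h0t (hder htI)
          (continuousOn_const (c := κ))
          (fun r hr => hflux r ⟨hr.1, hr.2.trans_lt ht.2⟩ (hE5 r hr)) hs
        rw [intervalIntegral.integral_const, smul_eq_mul] at hG
        refine hG.trans (mul_le_mul_of_nonneg_left (Real.exp_le_exp.2 ?_) (hW0 0))
        nlinarith [hs.1, hs.2, ht.2]
  intro t ht
  have h1 := hapriori t ht
  simp only [hW, hMb, hκ] at h1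
  have h2 : gradNormSq (u t) ≤ gradNormSq (u 0) * Real.exp (2 * c₄ * K₀ ^ 2 * T) := by
    nlinarith [h1, Real.exp_pos (2 * c₄ * K₀ ^ 2 * T)]
  exact h2

/-! ### §3 Theorem 1.1 in continuation form, and its blow-up reading -/

/-- **Berselli's Theorem 1.1 on `T³`, continuation form.** Printed (p. 4305): "Let us consider
either the space-periodic problem (`x ∈ 𝕋³`) or the Cauchy problem (`x ∈ ℝ³`). Let `u` be a
Leray–Hopf weak solution of the NSE in `(0, T)`, with `u₀ ∈ H¹`. Then, there exist constants
`λ = λ(ν, T, ‖∇u₀‖) > 0` and `C̄₁ = C̄₁(ν, T, ‖∇u₀‖, λ) > 0` such that if a.e. `t ∈ ]0, T[`, it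
holds `sin∠(ω̂(x, t), ω̂(y, t)) ⩽ C̄₁`, (4) where `y` are the six grid-points `y = x ± λeⱼ`,
`j = 1, 2, 3`, being `eⱼ` the unit vector in the `j`-Cartesian-coordinate direction, then `u` is
smooth in `[0, T]`." Typed on the unit torus `T^d`, `card d = 3` read through a frame `e`, for
a classical solution `(u, p)` of the unforced equations (`ν > 0`) on `[0, T) × T^d` with
mean-zero velocity slices: there is `λ₀ > 0` such that for every `0 < λ ≤ λ₀` and every `C̄₁`
with `0 ≤ C̄₁ ≤ λ(ν/2)^{3/4}` (the printed smallness condition on `C̄₁`, p. 4310), if for all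
`t ∈ [0, T)` the vorticity `ω(t)` read in the frame (`ωₖ = W_{k⁺k⁺⁺}(u(t))`) satisfies (4) in
the form the printed proof uses it, `|ω(x) × ω(x + heⱼ)| ≤ C̄₁ |ω(x)| |ω(x + heⱼ)|` for all `x`,
`j` and both `h = ±λ` (the six grid points), then the solution continues to a classical solution
with mean-zero slices on a closed interval `[0, T']`, `T' > T`, equal to `u` on `[0, T)`.
HONEST SCOPE: a PRINTED conditional regularity criterion typed as printed for the classical
class — criterion-only; no claim about solutions beyond the cited theorem; no node of this cell
decided. Deviations (module docstring): constants per-solution existential — dependence on the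
initial datum not rendered; the typed statement is implied by the printed one (`λ₀` exists per
solution; the printed `λ(ν, T, ‖∇u₀‖)` rests on the paper's sketched time-weighted estimates and
is NOT typed; the smallness of `λ` chosen inside the printed proof is the explicit hypothesis
`λ ≤ λ₀`); `‖u‖_{H⁵} := (sobolevEnergy 5 u)^{1/2}` and the `∑ⱼ` reading of `|ω × ∇ω|` inherited
from `TorusVorticityDirectionSixPoint`; Leray–Hopf ↦ classical on `[0, T)`; "smooth in `[0, T]`"
↦ continuation past `T`; unit torus. Proof: the a priori bound
`Torus.exists_gradNormSq_le_exp_of_sixPoint` and the enstrophy door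
`Torus.classicalNS_continuation_of_gradNormSq_le` ("the standard result of continuation for
strong solutions", RRS 2016 Lemma 6.11).
[cite: Berselli2023, Thm 1.1 (p. 4305)] -/
theorem Torus.classicalNS_continuation_of_sixPoint (e : d ≃ Fin 3) {ν T : ℝ} (hν : 0 < ν)
    (hT : 0 < T) {u : ℝ → UnitAddTorus d → EuclideanSpace ℝ d} {p : ℝ → UnitAddTorus d → ℝ}
    (h : Torus.IsClassicalNSSolutionOn (Ico 0 T) ν 0 u p)
    (hmean : ∀ t ∈ Ico 0 T, HasZeroMean (u t)) :
    ∃ lam₀ : ℝ, 0 < lam₀ ∧ ∀ (lam C₁ : ℝ), 0 < lam → lam ≤ lam₀ → 0 ≤ C₁ →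
      C₁ ≤ lam * (ν / 2) ^ (3 / 4 : ℝ) →
      (∀ t ∈ Ico 0 T, ∀ (ω : UnitAddTorus d → EuclideanSpace ℝ d),
        (∀ x k, ω x k = torusVorticityTensor (u t) (e.symm (e k + 1)) (e.symm (e k + 2)) x) →
        ∀ (x : UnitAddTorus d) (j : d) (h : ℝ), |h| = lam →
          Real.sqrt (∑ k, (ω x (e.symm (e k + 1)) *
              ω (x + proj (h • EuclideanSpace.single j (1 : ℝ))) (e.symm (e k + 2)) -
            ω x (e.symm (e k + 2)) *
              ω (x + proj (h • EuclideanSpace.single j (1 : ℝ))) (e.symm (e k + 1))) ^ 2) ≤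
            C₁ * ‖ω x‖ * ‖ω (x + proj (h • EuclideanSpace.single j (1 : ℝ)))‖) →
      ∃ T' : ℝ, T < T' ∧ ∃ (u' : ℝ → UnitAddTorus d → EuclideanSpace ℝ d)
        (p' : ℝ → UnitAddTorus d → ℝ), Torus.IsClassicalNSSolutionOn (Icc 0 T') ν 0 u' p' ∧
          (∀ t ∈ Icc 0 T', HasZeroMean (u' t)) ∧ ∀ t ∈ Ico 0 T, u' t = u t := by
  have hd : Fintype.card d = 3 := by simpa using Fintype.card_congr e
  obtain ⟨c₄, -, hc⟩ := Torus.exists_gradNormSq_le_exp_of_sixPoint (d := d) e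
  obtain ⟨lam₀, hlam₀, hb⟩ := hc hν hT h hmean
  refine ⟨lam₀, hlam₀, fun lam C₁ hlam hlamle hC₁ hC₁le h4 => ?_⟩
  exact Torus.classicalNS_continuation_of_gradNormSq_le hd hν hT h hmean
    (E₁ := gradNormSq (u 0) * Real.exp (2 * c₄ * (∫ x, ‖u 0 x‖ ^ 2) ^ 2 * T))
    (hb lam C₁ hlam hlamle hC₁ hC₁le h4)

/-- **Blow-up reading of Theorem 1.1 on `T³`** (the contrapositive, the way the printed proof is
organised, p. 4309: "Let us suppose that the solution `u` is strong in `[0, T[` and then, per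
absurdum, that at time `T` we have an 'epoch of irregularity,' which means that
`lim_{t→T⁻}‖ω(t)‖ = +∞`"): along a classical solution of the unforced equations on
`[0, T) × T^d` (`card d = 3`, `ν > 0`, mean-zero slices) whose enstrophy `‖∇u(t)‖₂²` is unbounded
on `[0, T)`, there is `λ₀ > 0` such that for every `0 < λ ≤ λ₀` and every
`0 ≤ C̄₁ ≤ λ(ν/2)^{3/4}` condition (4) FAILS somewhere: at some time `t < T`, point `x`,
direction `j` and `h = ±λ`, `C̄₁ |ω(x, t)| |ω(x + heⱼ, t)| < |ω(x, t) × ω(x + heⱼ, t)|`.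
HONEST SCOPE: a PRINTED conditional regularity criterion typed as printed for the classical
class — criterion-only; no claim about solutions beyond the cited theorem; no node of this cell
decided; deviations as in `Torus.classicalNS_continuation_of_sixPoint` (constants per-solution
existential — dependence on the initial datum not rendered; the typed statement is implied by
the printed one). Through `Torus.classicalNS_not_continuation_of_not_bddAbove_gradNormSq'`.
[cite: Berselli2023, Thm 1.1 (p. 4305), proof by contradiction (p. 4309)] -/
theorem Torus.exists_sixPoint_lt_of_not_bddAbove_gradNormSq (e : d ≃ Fin 3) {ν T : ℝ}
    (hν : 0 < ν) (hT : 0 < T) {u : ℝ → UnitAddTorus d → EuclideanSpace ℝ d}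
    {p : ℝ → UnitAddTorus d → ℝ} (h : Torus.IsClassicalNSSolutionOn (Ico 0 T) ν 0 u p)
    (hmean : ∀ t ∈ Ico 0 T, HasZeroMean (u t))
    (hunb : ¬ BddAbove ((fun t => gradNormSq (u t)) '' Ico 0 T)) :
    ∃ lam₀ : ℝ, 0 < lam₀ ∧ ∀ (lam C₁ : ℝ), 0 < lam → lam ≤ lam₀ → 0 ≤ C₁ →
      C₁ ≤ lam * (ν / 2) ^ (3 / 4 : ℝ) →
      ∃ t ∈ Ico 0 T, ∃ ω : UnitAddTorus d → EuclideanSpace ℝ d,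
        (∀ x k, ω x k = torusVorticityTensor (u t) (e.symm (e k + 1)) (e.symm (e k + 2)) x) ∧
        ∃ (x : UnitAddTorus d) (j : d) (h : ℝ), |h| = lam ∧
          C₁ * ‖ω x‖ * ‖ω (x + proj (h • EuclideanSpace.single j (1 : ℝ)))‖ <
            Real.sqrt (∑ k, (ω x (e.symm (e k + 1)) *
                ω (x + proj (h • EuclideanSpace.single j (1 : ℝ))) (e.symm (e k + 2)) -
              ω x (e.symm (e k + 2)) *
                ω (x + proj (h • EuclideanSpace.single j (1 : ℝ))) (e.symm (e k + 1))) ^ 2) := by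
  obtain ⟨lam₀, hlam₀, hmain⟩ := Torus.classicalNS_continuation_of_sixPoint e hν hT h hmean
  refine ⟨lam₀, hlam₀, fun lam C₁ hlam hle hC₁ hC₁le => ?_⟩
  by_contra hcon
  push Not at hcon
  exact Torus.classicalNS_not_continuation_of_not_bddAbove_gradNormSq' hν.le hT h hunb
    (hmain lam C₁ hlam hle hC₁ hC₁le fun t ht ω hω x j h' hh' => hcon t ht ω hω x j h' hh')

end Literature.Analysis.FluidPDE

namespace Literature.Analysis.FluidPDE

open Literature.Analysis.FunctionSpaces Literature.Analysis.FunctionSpaces.Torus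

variable {d : Type*} [Fintype d] [DecidableEq d]

/-! ### §4 Uniform constants: `λ₀ = λ₀(ν, T, ‖u(0)‖_{H⁵})` (Lemma 3.3 with `u₀ ∈ H⁵`, as printed)

The printed Lemma 3.3 (p. 4308) reads: "Let `u₀ ∈ H⁵`, and let `‖u(t)‖_{H¹} < ∞` for all
`t ∈ [0, T₁]`. Then, it follows that `‖u(t)‖_{H⁵} ⩽ Φ(t)` for all `t ∈ [0, T₁]`, for some function
`Φ(t) : [0, T₁] → ℝ⁺` depending (in a computable way) on `ν`, `T`, and `‖u(t)‖_{H¹}`."; its proof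
(pp. 4308–4309) produces `Φ = C‖A^{5/2}u₀‖e^{C(5)f₅(t)/(2ν)}` from `ν`, `T`, the `H¹` level and
`‖A^{5/2}u₀‖`. Accordingly the printed `λ`, `C̄₁` are uniform over all solutions whose datum lies in
a fixed `H⁵` ball (before the sketched reduction to `‖∇u₀‖` by time weights, which is NOT typed).
This section types that uniformity: the compactness step of §1 (a gradient bound on `[0, T/2]`) is
replaced by a quantitative short-time gradient bound from the data's `H³`-type energies (the
ladder in Grönwall form closed by the Agmon inequality `|∇u|² ≤ (2/π²)E₂^{1/2}E₃^{1/2}` through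
the continuity argument), so that `λ₀` depends on `ν`, `T` and an upper bound `M` of
`sobolevEnergy 5 (u 0)` only. Scope of §4: §§1–3 are untouched; uniformity is asserted only across
solutions with `sobolevEnergy 5 (u 0) ≤ M` for a fixed `M` (nothing is claimed about the
per-solution `λ₀` of §3 beyond that class); the printed `λ = λ(ν, T, ‖∇u₀‖)` (p. 4305, via the
time-weighted estimates sketched on p. 4310) is NOT typed — TODO(general form). Search for
candidate a priori estimates; no regularity claim. -/

namespace Berselli2023

/-- `E_1(v) = ‖∇v‖₂²`. (Proof device.) [folklore] -/
private theorem wordEnergy_one_eq_gradNormSq_dev {v : UnitAddTorus d → EuclideanSpace ℝ d}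
    (hv : IsSmooth v) : Torus.wordEnergy 1 v = gradNormSq v := by
  rw [Torus.wordEnergy_succ', gradNormSq]
  have hint : ∀ i, Integrable (fun x => ‖Torus.partialDeriv i v x‖ ^ 2) volume := fun i =>
    ((hv.partialDeriv i).continuous.norm.pow 2).integrable_unitAddTorus
  rw [integral_finsetSum _ fun i _ => hint i]
  simp

/-- **`|∇v(x)|² ≤ (E₂(v) + E₃(v))/π²`** on `T³` for smooth mean-zero `v` (Agmon at rung one,
`Torus.sum_norm_sq_wordDeriv_le_agmon_wordEnergy`, and `2√a√b ≤ a + b`). (Proof device.)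
[folklore] -/
private theorem sum_norm_sq_partialDeriv_le_wordEnergy (hd : Fintype.card d = 3)
    {v : UnitAddTorus d → EuclideanSpace ℝ d} (hv : IsSmooth v) (hmean : HasZeroMean v)
    (x : UnitAddTorus d) :
    ∑ i, ‖Torus.partialDeriv i v x‖ ^ 2 ≤
      (Torus.wordEnergy 2 v + Torus.wordEnergy 3 v) / π ^ 2 := by
  have h1 := Torus.sum_norm_sq_wordDeriv_le_agmon_wordEnergy hd hv hmean 1 x
  have hre : ∑ α : Fin 1 → d, ‖Torus.wordDeriv (List.ofFn α) v x‖ ^ 2 =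
      ∑ i, ‖Torus.partialDeriv i v x‖ ^ 2 := by
    rw [← (Equiv.funUnique (Fin 1) d).symm.sum_comp]
    refine Finset.sum_congr rfl fun i _ => ?_
    have : List.ofFn ((Equiv.funUnique (Fin 1) d).symm i) = [i] := by
      simp [List.ofFn_succ]
    rw [this, Torus.wordDeriv_singleton]
  rw [hre] at h1
  have h2 : 2 * Real.sqrt (Torus.wordEnergy 2 v) * Real.sqrt (Torus.wordEnergy 3 v) ≤
      Torus.wordEnergy 2 v + Torus.wordEnergy 3 v := by
    nlinarith [sq_nonneg (Real.sqrt (Torus.wordEnergy 2 v) - Real.sqrt (Torus.wordEnergy 3 v)),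
      Real.sq_sqrt (Torus.wordEnergy_nonneg 2 v), Real.sq_sqrt (Torus.wordEnergy_nonneg 3 v)]
  have hπ : 0 < π ^ 2 := by positivity
  calc ∑ i, ‖Torus.partialDeriv i v x‖ ^ 2
      ≤ 2 / π ^ 2 * Real.sqrt (Torus.wordEnergy 2 v) * Real.sqrt (Torus.wordEnergy 3 v) := h1
    _ = (2 * Real.sqrt (Torus.wordEnergy 2 v) * Real.sqrt (Torus.wordEnergy 3 v)) / π ^ 2 := by
        ring
    _ ≤ (Torus.wordEnergy 2 v + Torus.wordEnergy 3 v) / π ^ 2 :=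
        div_le_div_of_nonneg_right h2 hπ.le

/-- **Quantitative short-time gradient bound from the data** (the first rungs of the ladder closed
by Agmon's inequality): there is `c > 0` depending on `d` only such that along every classical
solution of the unforced equations (`ν ≥ 0`) on `[0, T) × T^d`, `card d = 3`, with mean-zero slices
and `E₂(u(0)) + E₃(u(0)) ≤ S₀`, one has `∑ᵢ‖∂ᵢu(t, x)‖² ≤ 4(S₀ + 1)/π²` for all `x` and all
`t ∈ [0, T)` with `t ≤ (c √(S₀ + 1))⁻¹`. (Proof device.) [folklore] -/
private theorem exists_shortTime_sum_norm_sq_partialDeriv_le (hd : Fintype.card d = 3) :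
    ∃ c : ℝ, 0 < c ∧ ∀ {ν T : ℝ} {u : ℝ → UnitAddTorus d → EuclideanSpace ℝ d}
      {p : ℝ → UnitAddTorus d → ℝ}, 0 ≤ ν → 0 < T →
      Torus.IsClassicalNSSolutionOn (Ico 0 T) ν 0 u p → (∀ t ∈ Ico 0 T, HasZeroMean (u t)) →
      ∀ {S₀ : ℝ}, Torus.wordEnergy 2 (u 0) + Torus.wordEnergy 3 (u 0) ≤ S₀ →
      ∀ t ∈ Ico 0 T, t ≤ (c * Real.sqrt (S₀ + 1))⁻¹ →
        ∀ x, ∑ i, ‖Torus.partialDeriv i (u t) x‖ ^ 2 ≤ 4 * (S₀ + 1) / π ^ 2 := by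
  obtain ⟨c₂, hc₂0, hc₂⟩ := Torus.exists_wordEnergy_le_exp d 2
  obtain ⟨c₃, hc₃0, hc₃⟩ := Torus.exists_wordEnergy_le_exp d 3
  -- `c` large enough that `2 (max c₂ c₃) (2√(S₀+1)/π) t ≤ log 2` whenever `c √(S₀+1) t ≤ 1`
  set cm : ℝ := max c₂ c₃ with hcm
  have hcm0 : 0 ≤ cm := le_max_of_le_left hc₂0
  refine ⟨8 * cm / π + 1, by positivity, fun {ν T u p} hν hT h hmean {S₀} hS₀ t ht htle x => ?_⟩
  have hπ : 0 < π := Real.pi_pos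
  have hS00 : 0 ≤ S₀ :=
    (add_nonneg (Torus.wordEnergy_nonneg _ _) (Torus.wordEnergy_nonneg _ _)).trans hS₀
  set R : ℝ := Real.sqrt (S₀ + 1) with hR
  have hR0 : 0 < R := Real.sqrt_pos.2 (by linarith)
  have hRsq : R ^ 2 = S₀ + 1 := Real.sq_sqrt (by linarith)
  -- the continuity argument for `W = E₂ + E₃`, bootstrap level `4(S₀+1)`, target `2(S₀+1)`
  set W : ℝ → ℝ := fun s => Torus.wordEnergy 2 (u s) + Torus.wordEnergy 3 (u s) with hW
  set t₀ : ℝ := ((8 * cm / π + 1) * R)⁻¹ with ht₀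
  have ht₀0 : 0 < t₀ := by positivity
  set T₀ : ℝ := min T t₀ with hT₀
  have hT₀0 : 0 < T₀ := lt_min hT ht₀0
  have hsolI : ∀ {t₁ : ℝ}, t₁ ∈ Ioo 0 T → Torus.IsClassicalNSSolutionOn (Icc 0 t₁) ν 0 u p :=
    fun {t₁} ht₁ => h.mono (fun r hr => ⟨hr.1, hr.2.trans_lt ht₁.2⟩) (uniqueDiffOn_Icc ht₁.1)
  have hWcont : ∀ {t₁ : ℝ}, t₁ ∈ Ioo 0 T → ∀ s ∈ Icc 0 t₁, ContinuousWithinAt W (Icc 0 t₁) s := by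
    intro t₁ ht₁ s hs
    have h2 := (hsolI ht₁).hasDerivWithinAt_half_wordEnergy ht₁.1 2 hs
    have h3 := (hsolI ht₁).hasDerivWithinAt_half_wordEnergy ht₁.1 3 hs
    have hc : ContinuousWithinAt (fun y => 2 * (2⁻¹ * Torus.wordEnergy 2 (u y)) +
        2 * (2⁻¹ * Torus.wordEnergy 3 (u y))) (Icc 0 t₁) s :=
      ((h2.const_mul 2).add (h3.const_mul 2)).continuousWithinAt
    refine hc.congr (fun y _ => ?_) ?_ <;> simp only [hW] <;> ring
  have hWc : ∀ t₁ ∈ Ioo 0 T₀, ContinuousOn W (Icc 0 t₁) := fun t₁ ht₁ s hs =>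
    hWcont ⟨ht₁.1, ht₁.2.trans_le (min_le_left _ _)⟩ s hs
  -- under the bootstrap hypothesis `W ≤ 4(S₀+1)` on `[0, t]`: the gradient bound, then Grönwall
  have hgrad_of : ∀ t ∈ Ico 0 T, (∀ s ∈ Icc 0 t, W s ≤ 4 * (S₀ + 1)) →
      ∀ s ∈ Icc 0 t, ∀ y, ∑ i, ‖Torus.partialDeriv i (u s) y‖ ^ 2 ≤ (2 * R / π) ^ 2 := by
    intro t ht hB s hs y
    have hsT : s ∈ Ico 0 T := ⟨hs.1, hs.2.trans_lt ht.2⟩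
    have hus : IsSmooth (u s) := h.smooth_velocity.isSmooth_slice hsT
    calc ∑ i, ‖Torus.partialDeriv i (u s) y‖ ^ 2
        ≤ (Torus.wordEnergy 2 (u s) + Torus.wordEnergy 3 (u s)) / π ^ 2 :=
          sum_norm_sq_partialDeriv_le_wordEnergy hd hus (hmean s hsT) y
      _ ≤ 4 * (S₀ + 1) / π ^ 2 := div_le_div_of_nonneg_right (hB s hs) (by positivity)
      _ = (2 * R / π) ^ 2 := by rw [div_pow, mul_pow, hRsq]; ring
  have hstep : ∀ t ∈ Ico 0 T₀, (∀ s ∈ Icc 0 t, W s ≤ 4 * (S₀ + 1)) →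
      ∀ s ∈ Icc 0 t, W s ≤ 2 * (S₀ + 1) := by
    intro t ht hB s hs
    have htT : t ∈ Ico 0 T := ⟨ht.1, ht.2.trans_le (min_le_left _ _)⟩
    rcases ht.1.eq_or_lt with h0t | h0t
    · have hs0 : s = 0 := le_antisymm (h0t ▸ hs.2) hs.1
      rw [hs0]; simp only [hW]; linarith
    have htI : t ∈ Ioo 0 T := ⟨h0t, htT.2⟩
    have hM := hgrad_of t htT hB
    have hM0 : 0 ≤ 2 * R / π := by positivity
    have e2 := hc₂ (hsolI htI) h0t hν (2 * R / π) hM0 hM hs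
    have e3 := hc₃ (hsolI htI) h0t hν (2 * R / π) hM0 hM hs
    -- the exponents are `≤ log 2` because `s ≤ t < t₀`
    have hst₀ : s ≤ t₀ := hs.2.trans (ht.2.le.trans (min_le_right _ _))
    have hexp : ∀ c', 0 ≤ c' → c' ≤ cm → Real.exp (2 * c' * (2 * R / π) * (s - 0)) ≤ 2 := by
      intro c' hc'0 hc'le
      have hx : 2 * c' * (2 * R / π) * (s - 0) ≤ Real.log 2 := by
        have hlog : (1 : ℝ) / 2 ≤ Real.log 2 := by
          have h2 := Real.log_two_gt_d9
          linarith
        have h1 : 2 * c' * (2 * R / π) * s ≤ 2 * cm * (2 * R / π) * t₀ := by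
          have : 2 * c' * (2 * R / π) ≤ 2 * cm * (2 * R / π) := by
            have := mul_le_mul_of_nonneg_right hc'le (by positivity : (0 : ℝ) ≤ 2 * R / π)
            nlinarith
          calc 2 * c' * (2 * R / π) * s ≤ 2 * c' * (2 * R / π) * t₀ :=
                mul_le_mul_of_nonneg_left hst₀ (by positivity)
            _ ≤ 2 * cm * (2 * R / π) * t₀ := mul_le_mul_of_nonneg_right this ht₀0.le
        have h2 : 2 * cm * (2 * R / π) * t₀ ≤ 1 / 2 := by
          have hden : 0 < (8 * cm / π + 1) * R := by positivity
          rw [ht₀, ← div_eq_mul_inv, div_le_iff₀ hden]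
          have ea : 2 * cm * (2 * R / π) = 4 * cm / π * R := by ring
          have eb : 1 / 2 * ((8 * cm / π + 1) * R) = 4 * cm / π * R + R / 2 := by ring
          rw [ea, eb]
          linarith
        rw [sub_zero]; linarith
      calc Real.exp (2 * c' * (2 * R / π) * (s - 0)) ≤ Real.exp (Real.log 2) :=
            Real.exp_le_exp.2 hx
        _ = 2 := Real.exp_log (by norm_num)
    have hE2 : Torus.wordEnergy 2 (u s) ≤ Torus.wordEnergy 2 (u 0) * 2 :=
      e2.trans (mul_le_mul_of_nonneg_left (hexp c₂ hc₂0 (le_max_left _ _))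
        (Torus.wordEnergy_nonneg _ _))
    have hE3 : Torus.wordEnergy 3 (u s) ≤ Torus.wordEnergy 3 (u 0) * 2 :=
      e3.trans (mul_le_mul_of_nonneg_left (hexp c₃ hc₃0 (le_max_right _ _))
        (Torus.wordEnergy_nonneg _ _))
    simp only [hW]
    nlinarith [hE2, hE3, hS₀, Torus.wordEnergy_nonneg 2 (u 0), Torus.wordEnergy_nonneg 3 (u 0)]
  have hboot := forall_le_of_prefix_bootstrap (T := T₀) hWc
    (by nlinarith [hS00] : 2 * (S₀ + 1) < 4 * (S₀ + 1)) (by simp only [hW]; linarith) hstep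
  -- conclusion: `t < t₀` via the bootstrap on `[0, t]`; `t = t₀` via continuity at `t`
  have htT₀ : t ∈ Ico 0 T := ht
  rcases lt_or_ge t t₀ with hlt | hge
  · have ht' : t ∈ Ico 0 T₀ := ⟨ht.1, lt_min ht.2 hlt⟩
    have hB : ∀ s ∈ Icc 0 t, W s ≤ 4 * (S₀ + 1) := fun s hs =>
      (hboot s ⟨hs.1, lt_of_le_of_lt hs.2 ht'.2⟩).trans (by nlinarith [hS00])
    have := hgrad_of t htT₀ hB t ⟨ht.1, le_rfl⟩ x
    calc ∑ i, ‖Torus.partialDeriv i (u t) x‖ ^ 2 ≤ (2 * R / π) ^ 2 := this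
      _ = 4 * (S₀ + 1) / π ^ 2 := by rw [div_pow, mul_pow, hRsq]; ring
  · -- `t = t₀` exactly (`t ≤ t₀` by hypothesis): bootstrap on `[0, t]` using continuity at `t`
    have hteq : t = t₀ := le_antisymm (by rw [ht₀]; exact htle) hge
    -- all `s < t` satisfy `W s ≤ 2(S₀+1)`; continuity of `W` on `[0, t]` gives `W t ≤ 2(S₀+1)`
    rcases ht.1.eq_or_lt with h0t | h0t
    · exfalso; rw [← h0t] at hteq; exact absurd hteq.symm ht₀0.ne'
    have htI : t ∈ Ioo 0 T := ⟨h0t, ht.2⟩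
    have hWct : ContinuousWithinAt W (Icc 0 t) t := hWcont htI t (right_mem_Icc.2 h0t.le)
    have hWt : W t ≤ 2 * (S₀ + 1) := by
      have hlim : Filter.Tendsto W (𝓝[Ico 0 t] t) (𝓝 (W t)) :=
        (hWct.mono Ico_subset_Icc_self).tendsto
      haveI : (𝓝[Ico 0 t] t).NeBot := by
        rw [← mem_closure_iff_nhdsWithin_neBot, closure_Ico h0t.ne]
        exact right_mem_Icc.2 h0t.le
      refine le_of_tendsto hlim ?_
      filter_upwards [self_mem_nhdsWithin] with s hs
      exact hboot s ⟨hs.1, lt_min (hs.2.trans ht.2) (hteq ▸ hs.2)⟩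
    have hB : ∀ s ∈ Icc 0 t, W s ≤ 4 * (S₀ + 1) := by
      intro s hs
      rcases hs.2.eq_or_lt with hst | hst
      · rw [hst]; nlinarith [hS00]
      · exact (hboot s ⟨hs.1, lt_min (hst.trans ht.2) (hteq ▸ hst)⟩).trans (by nlinarith [hS00])
    have := hgrad_of t htT₀ hB t ⟨ht.1, le_rfl⟩ x
    calc ∑ i, ‖Torus.partialDeriv i (u t) x‖ ^ 2 ≤ (2 * R / π) ^ 2 := this
      _ = 4 * (S₀ + 1) / π ^ 2 := by rw [div_pow, mul_pow, hRsq]; ring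


/-- `E₂ + E₃ ≤ sobolevEnergy 5` and `E_n ≤ sobolevEnergy 5` (`n ≤ 5`). (Proof device.) [folklore] -/
private theorem wordEnergy_two_add_three_le_sobolevEnergy_five
    (v : UnitAddTorus d → EuclideanSpace ℝ d) :
    Torus.wordEnergy 2 v + Torus.wordEnergy 3 v ≤ Torus.sobolevEnergy 5 v := by
  have h : ∑ n ∈ ({2, 3} : Finset ℕ), Torus.wordEnergy n v ≤ Torus.sobolevEnergy 5 v :=
    Finset.sum_le_sum_of_subset_of_nonneg (by decide) fun n _ _ => Torus.wordEnergy_nonneg n v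
  simpa [Finset.sum_pair (show (2 : ℕ) ≠ 3 by decide)] using h

/-- **Lemma 3.3 with `u₀ ∈ H⁵`, uniformly**: for `ν > 0`, `T > 0`, an enstrophy level `B₁` and a
data level `M` there is ONE `Φ ≥ 0` such that along every classical solution of the unforced
equations on `[0, T) × T^d` (`card d = 3`, mean-zero slices) with `sobolevEnergy 5 (u 0) ≤ M`: for
every `t < T`,
if `‖∇u‖₂² ≤ B₁` on `[0, t]` then `sobolevEnergy 5 (u s) ≤ Φ²` on `[0, t]` ("`Φ` … depending (in a
computable way) on `ν`, `T`, and `‖u(t)‖_{H¹}`", with `‖A^{5/2}u₀‖`, p. 4308–4309). Same ladder as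
`exists_sobolevEnergy_five_le`, the gradient bound on `[0, t₀]` now from
`exists_shortTime_sum_norm_sq_partialDeriv_le` (`t₀ = t₀(M)`), on `[t₀, t]` from the windows of
lapse `t₀/2`. (Proof device.) [cite: Berselli2023, Lemma 3.3 (p. 4308–4309)] -/
private theorem exists_sobolevEnergy_five_le_uniform (hd : Fintype.card d = 3) {ν T : ℝ}
    (hν : 0 < ν) (hT : 0 < T) (B₁ M : ℝ) :
    ∃ Φ : ℝ, 0 ≤ Φ ∧ ∀ {u : ℝ → UnitAddTorus d → EuclideanSpace ℝ d} {p : ℝ → UnitAddTorus d → ℝ},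
      Torus.IsClassicalNSSolutionOn (Ico 0 T) ν 0 u p → (∀ t ∈ Ico 0 T, HasZeroMean (u t)) →
      Torus.sobolevEnergy 5 (u 0) ≤ M →
      ∀ t ∈ Ico 0 T, (∀ s ∈ Icc 0 t, gradNormSq (u s) ≤ B₁) →
        ∀ s ∈ Icc 0 t, Torus.sobolevEnergy 5 (u s) ≤ Φ ^ 2 := by
  obtain ⟨c, hc0, hshort⟩ := exists_shortTime_sum_norm_sq_partialDeriv_le (d := d) hd
  set M' : ℝ := max M 0 with hM'
  have hM'0 : 0 ≤ M' := le_max_right _ _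
  set t₀ : ℝ := (c * Real.sqrt (M' + 1))⁻¹ with ht₀
  have ht₀0 : 0 < t₀ := by positivity
  have hτ : 0 < t₀ / 2 := by positivity
  obtain ⟨M₁, hM₁⟩ := exists_norm_partialDeriv_le_of_window (d := d) hd hν B₁ hτ
  set Mt : ℝ := Real.sqrt (4 * (M' + 1) / π ^ 2 + 3 * M₁ ^ 2) with hMt
  have hMt0 : 0 ≤ Mt := Real.sqrt_nonneg _
  have hMtsq : Mt ^ 2 = 4 * (M' + 1) / π ^ 2 + 3 * M₁ ^ 2 := Real.sq_sqrt (by positivity)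
  choose cN hcN0 hcN using fun N => Torus.exists_wordEnergy_le_exp d N
  set Φsq : ℝ := ∑ N ∈ Finset.range 6, M' * Real.exp (2 * cN N * Mt * T) with hΦsq
  have hΦsq0 : 0 ≤ Φsq := Finset.sum_nonneg fun N _ => by positivity
  refine ⟨Real.sqrt Φsq, Real.sqrt_nonneg _, fun {u p} h hmean hM t ht hB s hs => ?_⟩
  have hMM' : Torus.sobolevEnergy 5 (u 0) ≤ M' := hM.trans (le_max_left _ _)
  have hS₀ : Torus.wordEnergy 2 (u 0) + Torus.wordEnergy 3 (u 0) ≤ M' :=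
    (wordEnergy_two_add_three_le_sobolevEnergy_five (u 0)).trans hMM'
  -- the uniform gradient bound on `[0, t]`
  have hgrad : ∀ r ∈ Icc 0 t, ∀ x, ∑ i, ‖Torus.partialDeriv i (u r) x‖ ^ 2 ≤ Mt ^ 2 := by
    intro r hr x
    have hrT : r ∈ Ico 0 T := ⟨hr.1, hr.2.trans_lt ht.2⟩
    rcases le_or_gt r t₀ with hr0 | hr0
    · have h1 := hshort hν.le hT h hmean hS₀ r hrT (by rw [ht₀] at hr0; exact hr0) x
      rw [hMtsq]
      have : 0 ≤ 3 * M₁ ^ 2 := by positivity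
      linarith
    · have hsub : Icc (r - 2 * (t₀ / 2)) r ⊆ Ico 0 T := fun s' hs' =>
        ⟨by linarith [hs'.1], hs'.2.trans_lt hrT.2⟩
      have hB' : ∀ s' ∈ Icc (r - 2 * (t₀ / 2)) r, gradNormSq (u s') ≤ B₁ := fun s' hs' =>
        hB s' ⟨by linarith [hs'.1], hs'.2.trans hr.2⟩
      have hk : ∀ k, ‖Torus.partialDeriv k (u r) x‖ ^ 2 ≤ M₁ ^ 2 := fun k =>
        pow_le_pow_left₀ (norm_nonneg _) (hM₁ h hmean hsub hB' k x) 2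
      calc ∑ i, ‖Torus.partialDeriv i (u r) x‖ ^ 2 ≤ ∑ _i : d, M₁ ^ 2 :=
            Finset.sum_le_sum fun i _ => hk i
        _ = 3 * M₁ ^ 2 := by rw [Finset.sum_const, Finset.card_univ, hd]; simp
        _ ≤ Mt ^ 2 := by
            rw [hMtsq]; linarith [show (0 : ℝ) ≤ 4 * (M' + 1) / π ^ 2 from by positivity]
  rw [Real.sq_sqrt hΦsq0, Torus.sobolevEnergy]
  refine Finset.sum_le_sum fun N hN => ?_
  have hN5 : N ≤ 5 := Nat.lt_succ_iff.1 (Finset.mem_range.1 hN)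
  have hEN0 : Torus.wordEnergy N (u 0) ≤ M' :=
    (Torus.wordEnergy_le_sobolevEnergy hN5 (u 0)).trans hMM'
  have hexp1 : Torus.wordEnergy N (u s) ≤
      Torus.wordEnergy N (u 0) * Real.exp (2 * cN N * Mt * (s - 0)) := by
    rcases ht.1.eq_or_lt with h0t | h0t
    · have hs0 : s = 0 := le_antisymm (h0t ▸ hs.2) hs.1
      rw [hs0, sub_self, mul_zero, Real.exp_zero, mul_one]
    · have hsub : Icc 0 t ⊆ Ico 0 T := fun r hr => ⟨hr.1, hr.2.trans_lt ht.2⟩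
      exact hcN N (h.mono hsub (uniqueDiffOn_Icc h0t)) h0t hν.le Mt hMt0 hgrad hs
  have hexp2 : Real.exp (2 * cN N * Mt * (s - 0)) ≤ Real.exp (2 * cN N * Mt * T) :=
    Real.exp_le_exp.2 (mul_le_mul_of_nonneg_left (by linarith [hs.2, ht.2.le])
      (by have := hcN0 N; positivity))
  calc Torus.wordEnergy N (u s)
      ≤ Torus.wordEnergy N (u 0) * Real.exp (2 * cN N * Mt * (s - 0)) := hexp1
    _ ≤ M' * Real.exp (2 * cN N * Mt * T) :=
        mul_le_mul hEN0 hexp2 (Real.exp_nonneg _) hM'0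

end Berselli2023

/-- **The a priori bound of the printed proof with UNIFORM constants** (Lemma 3.3 as printed, "Let
`u₀ ∈ H⁵`"): there is `c₄ ≥ 0` (depending on `d` only) and, for every `ν > 0`, `T > 0` and data
level `M`, a `λ₀ = λ₀(ν, T, M) > 0` such that for EVERY classical solution of the unforced equations
on `[0, T) × T^d` (`card d = 3` read through `e`, mean-zero slices) with `sobolevEnergy 5 (u 0) ≤ M`
(`‖u(0)‖²_{H⁵} ≤ M`), all `0 < λ ≤ λ₀`, `0 ≤ C̄₁ ≤ λ(ν/2)^{3/4}` and the six-point condition (4) at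
`x ± λeⱼ` on `[0, T)`: `‖∇u(t)‖₂² ≤ ‖∇u(0)‖₂² e^{2c₄‖u(0)‖₂⁴T}` on `[0, T)`. HONEST SCOPE: a
PRINTED conditional regularity criterion typed as printed for the classical class — criterion-only;
no claim about solutions beyond the cited theorem; no node of this cell decided. Deviation from
`Torus.exists_gradNormSq_le_exp_of_sixPoint`: the dependence of `λ₀` on the solution is through
`ν`, `T` and the `H⁵` level `M` of the datum only (the print's Lemma 3.3 / `Φ = C‖A^{5/2}u₀‖e^{…}`);
the further printed reduction to `‖∇u₀‖` (sketched time-weighted estimates, p. 4310) is NOT typed.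
[cite: Berselli2023, proof of Thm 1.1 with Lemma 3.3 (pp. 4308–4310)] -/
theorem Torus.exists_gradNormSq_le_exp_of_sixPoint_uniform (e : d ≃ Fin 3) :
    ∃ c₄ : ℝ, 0 ≤ c₄ ∧ ∀ {ν T : ℝ} (M : ℝ), 0 < ν → 0 < T →
    ∃ lam₀ : ℝ, 0 < lam₀ ∧ ∀ {u : ℝ → UnitAddTorus d → EuclideanSpace ℝ d}
      {p : ℝ → UnitAddTorus d → ℝ},
      Torus.IsClassicalNSSolutionOn (Ico 0 T) ν 0 u p → (∀ t ∈ Ico 0 T, HasZeroMean (u t)) →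
      Torus.sobolevEnergy 5 (u 0) ≤ M →
      ∀ (lam C₁ : ℝ), 0 < lam → lam ≤ lam₀ → 0 ≤ C₁ → C₁ ≤ lam * (ν / 2) ^ (3 / 4 : ℝ) →
        (∀ t ∈ Ico 0 T, ∀ (ω : UnitAddTorus d → EuclideanSpace ℝ d),
          (∀ x k, ω x k = torusVorticityTensor (u t) (e.symm (e k + 1)) (e.symm (e k + 2)) x) →
          ∀ (x : UnitAddTorus d) (j : d) (h : ℝ), |h| = lam →
            Real.sqrt (∑ k, (ω x (e.symm (e k + 1)) *
                ω (x + proj (h • EuclideanSpace.single j (1 : ℝ))) (e.symm (e k + 2)) -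
              ω x (e.symm (e k + 2)) *
                ω (x + proj (h • EuclideanSpace.single j (1 : ℝ))) (e.symm (e k + 1))) ^ 2) ≤
              C₁ * ‖ω x‖ * ‖ω (x + proj (h • EuclideanSpace.single j (1 : ℝ)))‖) →
        ∀ t ∈ Ico 0 T, gradNormSq (u t) ≤
          gradNormSq (u 0) * Real.exp (2 * c₄ * (∫ x, ‖u 0 x‖ ^ 2) ^ 2 * T) := by
  have hd : Fintype.card d = 3 := by simpa using Fintype.card_congr e
  obtain ⟨c₃, c₄, hc₃, hc₄, h6⟩ := Torus.integral_vorticityStretching_le_of_sixPoint (d := d) e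
  refine ⟨c₄, hc₄, fun {ν T} M hν hT => ?_⟩
  -- uniform bootstrap level from the data level `M`
  set M' : ℝ := max M 0 with hM'
  have hM'0 : 0 ≤ M' := le_max_right _ _
  set Bst : ℝ := 2⁻¹ * M' * Real.exp (2 * c₄ * M' ^ 2 * T) + 1 with hBst
  have hBst0 : 0 < Bst := by positivity
  set B₁ : ℝ := 2 * Bst with hB₁
  obtain ⟨Φ, hΦ0, hΦ⟩ := Berselli2023.exists_sobolevEnergy_five_le_uniform hd hν hT B₁ M
  refine ⟨ν / (c₃ * Φ + 1), by positivity,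
    fun {u p} h hmean hM lam C₁ hlam hlamle hC₁ hC₁le h4 => ?_⟩
  have hlamΦ : c₃ * lam * Φ ≤ ν := by
    have h1 : c₃ * Φ * lam ≤ c₃ * Φ * (ν / (c₃ * Φ + 1)) :=
      mul_le_mul_of_nonneg_left hlamle (by positivity)
    have h2 : c₃ * Φ * (ν / (c₃ * Φ + 1)) ≤ ν := by
      rw [mul_div_assoc', div_le_iff₀ (by positivity)]
      nlinarith [mul_nonneg hc₃ hΦ0, hν.le]
    nlinarith
  -- the data: `‖u(0)‖₂² = E₀ ≤ M'`, `‖∇u(0)‖₂² = E₁ ≤ M'`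
  have hMM' : Torus.sobolevEnergy 5 (u 0) ≤ M' := hM.trans (le_max_left _ _)
  have hu0 : IsSmooth (u 0) := h.smooth_velocity.isSmooth_slice ⟨le_rfl, hT⟩
  set K₀ : ℝ := ∫ x, ‖u 0 x‖ ^ 2 with hK₀
  have hK₀0 : 0 ≤ K₀ := integral_nonneg fun x => by positivity
  have hK₀M : K₀ ≤ M' := by
    have h0 := Torus.wordEnergy_le_sobolevEnergy (show 0 ≤ 5 by norm_num) (u 0)
    rw [Torus.wordEnergy_zero] at h0
    exact h0.trans hMM'
  have hG₀M : gradNormSq (u 0) ≤ M' := by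
    have h1 := Torus.wordEnergy_le_sobolevEnergy (show 1 ≤ 5 by norm_num) (u 0)
    rw [Berselli2023.wordEnergy_one_eq_gradNormSq_dev hu0] at h1
    exact h1.trans hMM'
  set κ : ℝ := 2 * c₄ * K₀ ^ 2 with hκ
  have hκ0 : 0 ≤ κ := by positivity
  have hκM : κ ≤ 2 * c₄ * M' ^ 2 := by
    have := pow_le_pow_left₀ hK₀0 hK₀M 2
    nlinarith
  set W : ℝ → ℝ := fun s => 2⁻¹ * gradNormSq (u s) with hW
  have hW0 : ∀ s, 0 ≤ W s := fun s => mul_nonneg (by norm_num) (gradNormSq_nonneg _)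
  set Mb : ℝ := W 0 * Real.exp (κ * T) with hMb
  have hMbBst : Mb < Bst := by
    have h1 : W 0 ≤ 2⁻¹ * M' := by simp only [hW]; linarith
    have h2 : Real.exp (κ * T) ≤ Real.exp (2 * c₄ * M' ^ 2 * T) :=
      Real.exp_le_exp.2 (mul_le_mul_of_nonneg_right hκM hT.le)
    have h3 : Mb ≤ 2⁻¹ * M' * Real.exp (2 * c₄ * M' ^ 2 * T) :=
      mul_le_mul h1 h2 (Real.exp_nonneg _) (by positivity)
    rw [hBst]; linarith
  -- the solution on closed subintervals, the flux `D` of `W = ½‖∇u‖₂²`, continuity of `W`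
  have hsolI : ∀ {t : ℝ}, t ∈ Ioo 0 T → Torus.IsClassicalNSSolutionOn (Icc 0 t) ν 0 u p :=
    fun {t} ht => h.mono (fun r hr => ⟨hr.1, hr.2.trans_lt ht.2⟩) (uniqueDiffOn_Icc ht.1)
  set D : ℝ → ℝ := fun s => -ν * (∫ x, ‖Torus.laplacian (u s) x‖ ^ 2) +
    ∫ x, ⟪Torus.convect (u s) (u s) x - (0 : ℝ → UnitAddTorus d → EuclideanSpace ℝ d) s x,
      Torus.laplacian (u s) x⟫ with hD
  have hder : ∀ {t : ℝ}, t ∈ Ioo 0 T → ∀ s ∈ Icc 0 t, HasDerivWithinAt W (D s) (Icc 0 t) s :=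
    fun {t} ht s hs => (hsolI ht).hasDerivWithinAt_half_gradNormSq ht.1 hs
  have hWc : ∀ t ∈ Ioo 0 T, ContinuousOn W (Icc 0 t) :=
    fun t ht s hs => (hder ht s hs).continuousWithinAt
  -- the flux bound at every time with `‖u(s)‖_{H⁵} ≤ Φ`
  have hflux : ∀ s ∈ Ico 0 T, Torus.sobolevEnergy 5 (u s) ≤ Φ ^ 2 → D s ≤ κ * W s := by
    intro s hs hE5
    have hus : IsSmooth (u s) := h.smooth_velocity.isSmooth_slice hs
    have hdiv : IsDivFree (u s) := h.divFree s hs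
    set ω : UnitAddTorus d → EuclideanSpace ℝ d := fun x =>
      WithLp.toLp 2 fun k => torusVorticityTensor (u s) (e.symm (e k + 1)) (e.symm (e k + 2)) x
      with hωdef
    have hω : ∀ x k, ω x k =
        torusVorticityTensor (u s) (e.symm (e k + 1)) (e.symm (e k + 2)) x := fun x k => rfl
    have hst := h6 (u s) hus (hmean s hs) hdiv ω hω lam C₁ lam hlam hC₁ (abs_of_pos hlam)
      (fun x j => h4 s hs ω hω x j lam (abs_of_pos hlam))
    have hfl := Berselli2023.enstrophyFlux_le e hν hc₃ hus hdiv hω hlam hC₁ hC₁le hΦ0 hE5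
      hlamΦ hst
    have hen : ∫ x, ‖u s x‖ ^ 2 ≤ K₀ := by
      have hk := kineticEnergy_le_of_le hν.le h (convex_Ico 0 T) hs.1
        (fun r hr => ⟨hr.1, hr.2.trans_lt hs.2⟩)
      simp only [kineticEnergy] at hk
      linarith
    have hen0 : 0 ≤ ∫ x, ‖u s x‖ ^ 2 := integral_nonneg fun x => by positivity
    have hD' : D s = -ν * (∫ x, ‖Torus.laplacian (u s) x‖ ^ 2) +
        ∫ x, ⟪Torus.convect (u s) (u s) x, Torus.laplacian (u s) x⟫ := by
      simp only [hD, Pi.zero_apply, sub_zero]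
    rw [hD']
    calc -ν * (∫ x, ‖Torus.laplacian (u s) x‖ ^ 2) +
          ∫ x, ⟪Torus.convect (u s) (u s) x, Torus.laplacian (u s) x⟫
        ≤ c₄ * (∫ x, ‖u s x‖ ^ 2) ^ 2 * gradNormSq (u s) := hfl
      _ ≤ c₄ * K₀ ^ 2 * gradNormSq (u s) := by
          have := pow_le_pow_left₀ hen0 hen 2
          have hg := gradNormSq_nonneg (u s)
          gcongr
      _ = κ * W s := by simp only [hκ, hW]; ring
  -- the continuity argument with the UNIFORM bootstrap level `Bst`
  have hapriori : ∀ t ∈ Ico 0 T, W t ≤ Mb := by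
    refine Berselli2023.forall_le_of_prefix_bootstrap hWc hMbBst ?_ ?_
    · exact le_mul_of_one_le_right (hW0 0) (Real.one_le_exp (by positivity))
    · intro t ht hboot s hs
      have hB : ∀ r ∈ Icc 0 t, gradNormSq (u r) ≤ B₁ := fun r hr => by
        have := hboot r hr
        simp only [hW] at this
        rw [hB₁]; linarith
      have hE5 : ∀ r ∈ Icc 0 t, Torus.sobolevEnergy 5 (u r) ≤ Φ ^ 2 := hΦ h hmean hM t ht hB
      rcases ht.1.eq_or_lt with h0t | h0t
      · have hs0 : s = 0 := le_antisymm (h0t ▸ hs.2) hs.1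
        rw [hs0]
        exact le_mul_of_one_le_right (hW0 0) (Real.one_le_exp (by positivity))
      · have htI : t ∈ Ioo 0 T := ⟨h0t, ht.2⟩
        have hG := le_mul_exp_integral_of_hasDerivWithinAt_le_mul h0t (hder htI)
          (continuousOn_const (c := κ))
          (fun r hr => hflux r ⟨hr.1, hr.2.trans_lt ht.2⟩ (hE5 r hr)) hs
        rw [intervalIntegral.integral_const, smul_eq_mul] at hG
        refine hG.trans (mul_le_mul_of_nonneg_left (Real.exp_le_exp.2 ?_) (hW0 0))
        nlinarith [hs.1, hs.2, ht.2]
  intro t ht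
  have h1 := hapriori t ht
  simp only [hW, hMb, hκ] at h1
  nlinarith [h1, Real.exp_pos (2 * c₄ * K₀ ^ 2 * T)]

/-- **Berselli's Theorem 1.1 on `T³`, continuation form with UNIFORM constants**
`λ₀ = λ₀(ν, T, M)`, `M ≥ ‖u(0)‖²_{H⁵}` (the printed Lemma 3.3 starts from "`u₀ ∈ H⁵`"): for every
`ν > 0`, `T > 0` and `M` there is `λ₀ > 0` such that every classical solution of the unforced
equations on `[0, T) × T^d` (`card d = 3` read through `e`, mean-zero slices) with
`sobolevEnergy 5 (u 0) ≤ M` that satisfies the six-grid-point condition (4) at `x ± λeⱼ` on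
`[0, T)` for some `0 < λ ≤ λ₀` and `0 ≤ C̄₁ ≤ λ(ν/2)^{3/4}` continues to a classical solution with
mean-zero slices on a closed `[0, T']`, `T' > T`, equal to `u` on `[0, T)`. HONEST SCOPE: a PRINTED
conditional regularity criterion typed as printed for the classical class — criterion-only; no claim
about solutions beyond the cited theorem; no node of this cell decided. Deviations as in
`Torus.classicalNS_continuation_of_sixPoint`, except that the constants now depend on the datum
only through the `H⁵` level `M` (uniformly over solutions); the printed dependence on `‖∇u₀‖` alone
(sketched time-weighted estimates, p. 4310) is NOT typed — the typed statement is implied by the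
printed one. [cite: Berselli2023, Thm 1.1 (p. 4305) with Lemma 3.3 (p. 4308–4309)] -/
theorem Torus.classicalNS_continuation_of_sixPoint_uniform (e : d ≃ Fin 3) {ν T : ℝ} (hν : 0 < ν)
    (hT : 0 < T) (M : ℝ) :
    ∃ lam₀ : ℝ, 0 < lam₀ ∧ ∀ {u : ℝ → UnitAddTorus d → EuclideanSpace ℝ d}
      {p : ℝ → UnitAddTorus d → ℝ},
      Torus.IsClassicalNSSolutionOn (Ico 0 T) ν 0 u p → (∀ t ∈ Ico 0 T, HasZeroMean (u t)) →
      Torus.sobolevEnergy 5 (u 0) ≤ M →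
      ∀ (lam C₁ : ℝ), 0 < lam → lam ≤ lam₀ → 0 ≤ C₁ → C₁ ≤ lam * (ν / 2) ^ (3 / 4 : ℝ) →
        (∀ t ∈ Ico 0 T, ∀ (ω : UnitAddTorus d → EuclideanSpace ℝ d),
          (∀ x k, ω x k = torusVorticityTensor (u t) (e.symm (e k + 1)) (e.symm (e k + 2)) x) →
          ∀ (x : UnitAddTorus d) (j : d) (h : ℝ), |h| = lam →
            Real.sqrt (∑ k, (ω x (e.symm (e k + 1)) *
                ω (x + proj (h • EuclideanSpace.single j (1 : ℝ))) (e.symm (e k + 2)) -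
              ω x (e.symm (e k + 2)) *
                ω (x + proj (h • EuclideanSpace.single j (1 : ℝ))) (e.symm (e k + 1))) ^ 2) ≤
              C₁ * ‖ω x‖ * ‖ω (x + proj (h • EuclideanSpace.single j (1 : ℝ)))‖) →
        ∃ T' : ℝ, T < T' ∧ ∃ (u' : ℝ → UnitAddTorus d → EuclideanSpace ℝ d)
          (p' : ℝ → UnitAddTorus d → ℝ), Torus.IsClassicalNSSolutionOn (Icc 0 T') ν 0 u' p' ∧
            (∀ t ∈ Icc 0 T', HasZeroMean (u' t)) ∧ ∀ t ∈ Ico 0 T, u' t = u t := by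
  have hd : Fintype.card d = 3 := by simpa using Fintype.card_congr e
  obtain ⟨c₄, -, hc⟩ := Torus.exists_gradNormSq_le_exp_of_sixPoint_uniform (d := d) e
  obtain ⟨lam₀, hlam₀, hb⟩ := hc M hν hT
  refine ⟨lam₀, hlam₀, fun {u p} h hmean hM lam C₁ hlam hlamle hC₁ hC₁le h4 => ?_⟩
  exact Torus.classicalNS_continuation_of_gradNormSq_le hd hν hT h hmean
    (E₁ := gradNormSq (u 0) * Real.exp (2 * c₄ * (∫ x, ‖u 0 x‖ ^ 2) ^ 2 * T))
    (hb h hmean hM lam C₁ hlam hlamle hC₁ hC₁le h4)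

/-- **Blow-up reading with UNIFORM constants**: for every `ν > 0`, `T > 0` and data level `M` there
is `λ₀ = λ₀(ν, T, M) > 0` such that along EVERY classical solution of the unforced equations on
`[0, T) × T^d` (`card d = 3`, mean-zero slices) with `sobolevEnergy 5 (u 0) ≤ M` whose enstrophy is
unbounded on `[0, T)`, for all `0 < λ ≤ λ₀`, `0 ≤ C̄₁ ≤ λ(ν/2)^{3/4}` the six-point condition (4)
fails at some `t < T`, `x`, `j`, `h = ±λ`. HONEST SCOPE: a PRINTED conditional regularity criterion
typed as printed for the classical class — criterion-only; no claim about solutions beyond the cited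
theorem; no node of this cell decided.
[cite: Berselli2023, Thm 1.1 (p. 4305), proof by contradiction (p. 4309)] -/
theorem Torus.exists_sixPoint_lt_of_not_bddAbove_gradNormSq_uniform (e : d ≃ Fin 3) {ν T : ℝ}
    (hν : 0 < ν) (hT : 0 < T) (M : ℝ) :
    ∃ lam₀ : ℝ, 0 < lam₀ ∧ ∀ {u : ℝ → UnitAddTorus d → EuclideanSpace ℝ d}
      {p : ℝ → UnitAddTorus d → ℝ},
      Torus.IsClassicalNSSolutionOn (Ico 0 T) ν 0 u p → (∀ t ∈ Ico 0 T, HasZeroMean (u t)) →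
      Torus.sobolevEnergy 5 (u 0) ≤ M →
      ¬ BddAbove ((fun t => gradNormSq (u t)) '' Ico 0 T) →
      ∀ (lam C₁ : ℝ), 0 < lam → lam ≤ lam₀ → 0 ≤ C₁ → C₁ ≤ lam * (ν / 2) ^ (3 / 4 : ℝ) →
      ∃ t ∈ Ico 0 T, ∃ ω : UnitAddTorus d → EuclideanSpace ℝ d,
        (∀ x k, ω x k = torusVorticityTensor (u t) (e.symm (e k + 1)) (e.symm (e k + 2)) x) ∧
        ∃ (x : UnitAddTorus d) (j : d) (h : ℝ), |h| = lam ∧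
          C₁ * ‖ω x‖ * ‖ω (x + proj (h • EuclideanSpace.single j (1 : ℝ)))‖ <
            Real.sqrt (∑ k, (ω x (e.symm (e k + 1)) *
                ω (x + proj (h • EuclideanSpace.single j (1 : ℝ))) (e.symm (e k + 2)) -
              ω x (e.symm (e k + 2)) *
                ω (x + proj (h • EuclideanSpace.single j (1 : ℝ))) (e.symm (e k + 1))) ^ 2) := by
  obtain ⟨lam₀, hlam₀, hmain⟩ :=
    Torus.classicalNS_continuation_of_sixPoint_uniform e hν hT M
  refine ⟨lam₀, hlam₀, fun {u p} h hmean hM hunb lam C₁ hlam hle hC₁ hC₁le => ?_⟩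
  by_contra hcon
  push Not at hcon
  exact Torus.classicalNS_not_continuation_of_not_bddAbove_gradNormSq' hν.le hT h hunb
    (hmain h hmean hM lam C₁ hlam hle hC₁ hC₁le
      fun t ht ω hω x j h' hh' => hcon t ht ω hω x j h' hh')

end Literature.Analysis.FluidPDE
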